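/-
Copyright: statement-level skeleton of a published paper (lit-balaban cell, Phase-2 proof seat p39 gen 30). No proof claims
beyond what the kernel checks below.
-/
import Literature.MathematicalPhysics.QuantumFieldTheory.Balaban1983to89.B3Eq123IndexZeroTwo

/-!
# Bałaban, *(Higgs)₂,₃ quantum fields in a finite volume. III*, CMP 88 (1983) [Balaban1983Higgs3], pp. 417–418: THE VACUUM-ENERGY
# COUNTERTERM (1.24) AT THE INDEX `(α,β) = (0,3)` — the third right-derivative `(∂/∂λ)³ log∫dA∫dφ e^{−S^ε}∣_{λ=0⁺}` at `e = 0`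
# with print's series `δm² = λδm²_{(0,1)} + λ²δm²_{(0,2)}` of (1.23) INSERTED in the action (1.20), DERIVED by one-sided dominated
# differentiation to third order and EVALUATED by Wick's theorem: at print's `δm²_{(0,1)}` it is the single three-vertex vacuum
# graph of the Wick-ordered quartic interaction — the triangle with doubled lines, `64N(N+2)(N+8)Σε^{3d}(C^ε_0)²(C^ε_0)²(C^ε_0)²` —
# and `δm²_{(0,2)}` drops out

statement-level skeleton of published theorems with citation tags; proofs where landed; nothing here is a claim about the
Yang–Mills mass gap.

[cite: Balaban1983Higgs3, (1.24) p.417 (PDF 7) and the first paragraph of p.418 (PDF 8); (1.19)–(1.22) p.416 (PDF 6); (1.23) and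
the paragraph before it p.417; (1.6)–(1.7) p.413 (PDF 3)] [cite: GlimmJaffeQP1987, §8.3–8.5 (Gaussian integrals, integration by
parts / Wick's theorem, Feynman graphs, perturbation series), Cor. 8.3.2, (9.1.5)].
Unit `lit-balaban-p39-g30` (Phase-2 proof seat p39, gen 30), free-target protocol G.5-34(d), ZERO head weight: OPTIONAL LOCATED
MEMBER of row **B3.Eq1.24** of `HOME/lit-balaban-r15/ROWS-B3.md` (owner r15; head `proved`, decl of record r01's
`B1Sect1Statements.ModelData.e1R` / r15's `B3Sect1TwoPoint.E1of124R`, neither restated here); TAKING `HOME/STATUS.md`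
2026-08-24T13:40:44Z, owner r15 cc'd 13:42:30Z.  BRICK 15 of this seat's series on (1.19)–(1.24).  IMPORTED: BRICK 1
`B3Eq122FirstOrderWick` (this seat, gen 22: the free scalar weight `weight … m2 0` = the `e = 0` sector, `ExpGrowth`, the
Wick-ordered vertices and their contraction chain `derivAlong_wick4_1 … _4`, `_1k`, `_1kk`, `integral_wick4_rem2`, the sums
`integral_sumWick4`, `integral_wick4_wick2`, `norm_four_eq_wick`, `expGrowth_sum_wick4`; through it `B3WickVertexCalculus`
(`wick2`, `wick4`, `ibp_site`, `integral_norm_sq_mul`, `integral_wick4_mul`, `integral_wick4`), `B3WTCovariance` (`G_transl`,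
`G_diag`, `C0`, `transl`, `translEquiv`), `B3WT226Traces.Z_pos`) — since v1.1 THROUGH BRICK 12 `B3Eq123IndexZeroTwo` (gen 27:
the indices `(0,1)`, `(0,2)` at `e = 0` on both the two-point side and the vacuum side (1.24), §10 `iteratedDerivWithin_two_logZct`),
which is now IMPORTED (its farm olean is built since 2026-08-24T17:3xZ, importer probe rc 0) and whose one-sided moment calculus
§0–§3 (`weight_counterterm_eq`, `weight_mul_exp_quarter_mass`, `exp_neg_exponent_le`, `integrable_moment`, `moment_zero`,
`hasDerivAt_exp_exponent`, `hasDerivAt_moment`, `hasDerivWithinAt_moment_zero`, `hasDerivWithinAt_moment`, `moment_one_pos`,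
`moment_split`) §2 below uses BY NAME.  v1.0 (written while that olean was unbuilt, probe rc 75 «remote:stale:93:unbuilt»
2026-08-24T13:3xZ) carried PRIVATE statement-identical copies of them in its §0–§1; v1.1 deletes those copies (kept file-local: the
small growth/positivity helpers `expGrowth_pow`, `expGrowth_massForm'`/`expGrowth_V1` (= BRICK 12's `expGrowth_V_add_massForm`),
`neg_le_V1`, `exists_window`, private in BRICK 12 too); nothing of record was or is redeclared, every public declaration below is
unchanged.

PDF held: `paper:balaban1983-higgs-2-3-quantum-fields-finite-volume` (journal page = PDF page + 410); (1.24) and the prose around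
it were read for BRICKS 12/13 on the ×2 renders `run/shared/lean/pub/pub-balaban/b2b-balaban-ref1/pages/1983-cmp88-higgs23-III/
1983-cmp88-higgs23-III-p007-x2.png`, `…-p008-x2.png` (quotations below as verified there by ref-1 g107/g108 and ref-4 g90/g91), and
the first paragraph of p. 418 was RE-READ for this file on the OCR layer (`lit read … --pages 7-8`, 2026-08-24T13:5xZ; the OCR of
the display (1.24) itself is garbled and was not used).

THE PRINTED TEXT (verbatim).  P. 417: *"Now it is easy to define the vacuum energy counterterm E₁. It is defined by the following
perturbation expansion: E₁ = Σ_{1≤α+β≤n̄}(1/(α!β!))e^αλ^β(∂^{α+β}/∂e^α∂λ^β log∫dA∫dφ e^{−S^ε(A,φ)})∣_{e=λ=0} (1.24)"*; p. 418: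
*"with n̄ > 12. In S^ε, defined in (I.1.11), we of course have dropped the term E. Terms of this expansion are described by
connected graphs without external legs (vacuum graphs). To renormalize the theory it is sufficient to take the terms in the
expansion (1.24) restricted by the condition 2 ≦ α+2β ≦ 6; the other terms are convergent as ε → 0."*  ((I.1.11) = part I's
(1.11) = (1.20) + E: the mass counterterm `½δm²∣φ∣²` IS in `S^ε`; p. 417 *"we write δm² = Σ_{2≦α+2β≦4}e^αλ^βδm²_{(α,β)} and we
insert this into Σ^ε"* — at `e = 0` the inserted series is `λδm²_{(0,1)} + λ²δm²_{(0,2)}`, and (1.23) displays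
`δm²_{(0,1)}: −4(N+2)λC^ε_0(0)`.)

READING (ours, as in BRICKS 12–14 and r01's `e1R`).  The index `(α,β) = (0,3)` of (1.24) is the coefficient
`(1/(0!3!))·(∂/∂λ)³ log∫dA∫dφ e^{−S^ε}∣_{e=λ=0}`; at `e = 0` the vector-field integral is a `λ`-independent factor of
`∫dA∫dφ e^{−S^ε}` (the action (1.20) couples `A` to `φ` only through `e`), so it drops out of every `λ`-derivative of the
logarithm and the scalar integral `Z^{ct}(λ) = ∫dφ e^{−½⟨φ,(−Δ^ε+m²+δm²(λ))φ⟩ − λΣ_xε^d∣φ(x)∣⁴}` is the whole story (as in BRICK 1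
§13, BRICK 12 §10; BRICK 10 `twoPtJoint_zero_charge` for the two-point analogue).  The `λ`-derivative is ONE-SIDED at `0⁺`
(`e^{−λ∣φ∣⁴}` is not integrable for `λ < 0`): Mathlib's `iteratedDerivWithin 3 · (Set.Ici 0) 0`.  `α + 2β = 6`: this is the LAST
PURE-`λ` INDEX of p. 418's *"2 ≦ α+2β ≦ 6"* (r15's informal cell of B3.Eq1.24 lists `(2,0), (0,1), (4,0), (2,1), (0,2), (6,0),
(4,1), (2,2), (0,3)` as the indices that can be non-zero; `(2,0)` is BRICK 13, `(0,1), (0,2)` are BRICK 12 §10, the odd-`α` ones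
vanish by BRICK 13 §10).

WHICH TERM OF (1.24) THIS IS (owner r15's ask, 2026-08-24T13:41:41Z).  The body of record of row B3.Eq1.24 is r15's
`B3Sect1TwoPoint.E1of124R` = r01's `B1Sect1Statements.ModelData.e1R`: `E₁` as the truncated double series (1.24) with the
`λ`-derivatives ONE-SIDED at `0⁺`.  This file computes its `(α,β) = (0,3)` coefficient, `(1/(0!3!))·(∂/∂λ)³ log∫dA∫dφ
e^{−S^ε}∣_{e=0, λ=0⁺}`, for the action (1.20) WITH print's counterterm series inserted (p. 418 drops only `E` from `S^ε`), on
BRICK 1's concrete torus carrier — the carriers `e1R`/`E1of124R` are not bridged to it (an identification of readings, said here,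
not a theorem).  THE COMBINATORIC FACTOR'S PROVENANCE: print draws the graphs of (1.22)–(1.24) without factors (p. 416 *"Here
we did not write, and we will not write in the future, combinatoric factors before the graphs, understanding that they are a part
of the graphical description"*; p. 418 *"connected graphs without external legs (vacuum graphs)"*); the factor `64N(N+2)(N+8)` of
the doubled-line triangle is DERIVED below (§4) as the `O(N)`-weighted count of the complete Wick pairings of three Wick-ordered
`:∣φ∣⁴:` vertices without self-lines (each pair of vertices joined by exactly two lines; per index pair `64(N+8)(1 + 2δ_{ik})`,
`Σ_{i,k}(1 + 2δ_{ik}) = N(N+2)`; at `N = 1`: `1728 = (4!)³/2³ = C(4,2)·(4·3)·(4·3)·2`), and with print's prefactor `1/(0!3!)` and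
the sign of `−κ₃` the `(0,3)` term of `E₁` is `−(32/3)N(N+2)(N+8)λ³Σ_{y₁,y₂,y₃}ε^{3d}C^ε_0(y₂,y₁)²C^ε_0(y₃,y₁)²C^ε_0(y₃,y₂)²`
(`E1_term_03_at_dm2One`); `δm²_{(0,2)}` enters the `(0,3)` coefficient with the factor `3Cov₀(V₁,Q)`, which is `0` at print's
`δm²_{(0,1)}` (`integral_sumWick4_massForm`).

THE SETTING = BRICK 1's / BRICK 12's: the model torus `T^{(j)}_η` of `B3WT223Instance` (print's `T_ε`, `η = ε`, volume element
`w = η^d`, `c = η⁻¹`), fields `φ : T → ℝ^N` (`Cfg`), the Gaussian weight `W(φ) = e^{−½⟨φ,(−Δ^η+m²)φ⟩}` (in the docstrings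
`W` abbreviates `weight C η w c m2 0`, which the statements write out; `e_a` = `EuclideanSpace.basisFun (Fin N) ℝ a`), its propagator `C₀ = B3WTPropagator.G` (print's `C^ε_0`, `C^ε_0(0) =
B3WTCovariance.C0`), `V(φ) = Σ_yη^d∣φ(y)∣⁴` (the vertex (1.6)), `Q(φ) = Σ_zη^d∣φ(z)∣²` (`massForm`; the vertex (1.7) is `½δm²·Q`),
`V₁ = V + ½δ₁Q`, `κ = ½δ₂`: with `δm² = λδ₁ + λ²δ₂` the scalar weight of (1.20) at `e = 0` is `W·exp(−[λV₁ + λ²κQ])` (§0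
`weight_counterterm_eq'`, §5 `logZct_eq`).  Hypotheses throughout: `η^d > 0`, `m² > 0`; any level `j`, mesh, dimension `d`, number of
components `N`; `δ₁, δ₂ ∈ ℝ` arbitrary until print's value `δ₁ = −4(N+2)C^ε_0(0)` is inserted.

WHAT THIS FILE PROVES (theorems only; no definition, no named fact, no `sorry`; standard axioms).
* §0–§1 (private) the toolbox and BRICK 12's one-sided moment calculus for the exponent `λV + λ²κQ` on the window `0 ≤ λ < L`
  (`L ≤ 1`, `L∣κ∣ ≤ m²/4`): the moments `N_g(λ) = ∫We^{−(λV+λ²κQ)}g` have the derivative `−[N_{Vg} + 2λκN_{Qg}]` within `[0,∞)` at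
  every point of the window (dominated differentiation; at `0` dominated convergence of the difference quotients along `𝓝[>]0`).
* §2 **THE THIRD RIGHT-DERIVATIVE OF `log N_1` AT `0⁺`** (`iteratedDerivWithin_three_log`, private, [folklore]: if `M > 0` has
  derivative `M′` within `[0,∞)` on `[0,L)`, `M′` has derivative `M″` there and `M″` has right-derivative `c` at `0`, then
  `iteratedDerivWithin 3 (log∘M) (Set.Ici 0) 0 = c/M(0) − 3M′(0)M″(0)/M(0)² + 2M′(0)³/M(0)³`; fed with §1 three times:
  `N_1′ = −[N_V + 2λκN_Q]`, `N_1″ = N_{V²} + 2λκN_{QV} − 2κN_Q + 2λκ(N_{VQ} + 2λκN_{Q²})`, `N_1‴(0⁺) = −∫WV³ + 6κ∫WVQ`) ⇒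
  **`iteratedDerivWithin_three_logMoment`: for EVERY interaction `V ≥ −K` of exponential-linear growth and every `κ`,
  `iteratedDerivWithin 3 (λ ↦ log∫We^{−(λV+λ²κQ)}) (Set.Ici 0) 0 = −κ₃(V) + 6κ·Cov(V,Q)`** (`κ₃(V) = E[V³] − 3E[V²]E[V] +
  2E[V]³`, `Cov(V,Q) = E[VQ] − E[V]E[Q]`, `E = Z⁻¹∫W·`, written out as quotients of Gaussian integrals).
* §3 Wick tools (private): a leg against a Wick-ordered cubic integrates to zero (`integral_lin_w3`, `integral_w3_lin`: `∫W
  φ_m(z)·:φ_k∣φ∣²:(z′) = 0`, one integration by parts + BRICK 1 `integral_wick4_rem2`); the contraction rule for the Wick-ordered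
  quadratic remainder `P₂(z;i,k) = δ_{ki}(∣φ(z)∣² − (N+2)C(z,z)) + 2φ_i(z)φ_k(z)` (= `δ_{ki}:∣φ(z)∣²: + 2:φ_iφ_k:(z)`) into an
  observable (`integral_P2_mul`), and **the two-line kernel `integral_P2_P2`: `∫W P₂(z;i,k)P₂(z′;m,n) = 2C(z′,z)²·Z·[(N+4)δ_{ki}δ_{nm}
  + 2(δ_{im}δ_{kn} + δ_{km}δ_{in})]`**.
* §4 **THE TRIANGLE WITH DOUBLED LINES** — **`integral_wick4_wick4_wick4`: `∫W·:∣φ(y)∣⁴:·:∣φ(z)∣⁴:·:∣φ(z′)∣⁴: =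
  64N(N+2)(N+8)·C(z,y)²C(z′,y)²C(z′,z)²·Z`**: all four legs of the vertex at `y` contracted into the product of the other two
  (`B3WickVertexCalculus.integral_wick4_mul`, Leibniz over BRICK 1's contraction chain at `z` and at `z′`); of the sixteen terms a
  constant against `:∣φ∣⁴:` and a leg against a Wick-ordered cubic vanish, the three "two legs into each" terms are §3's two-line
  kernel; per index pair `64(N+8)u²u′²v²(1 + 2δ_{ik})`, `Σ_{i,k}(1+2δ_{ik}) = N(N+2)`; at `N = 1` the factor is `1728 = (4!)³/2³`,
  the number of pairings of three Wick-ordered `φ⁴`-vertices.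
* §5 **(1.24) AT THE INDEX `(0,3)`.**  `iteratedDerivWithin_three_logZct` (ANY `δ₁, δ₂`, cumulant form):
  **`(∂/∂λ)³ log Z^{ct}∣_{0⁺} = −κ₃(V₁) + 3δ₂·Cov(V₁,Q)`** — the third joint cumulant of the order-`λ` part of the exponent and three
  times the covariance of the `(0,2)` mass vertex with it; `logZct_eq` ((1.20)'s own spelling of the family: mass `m² + λδ₁ + λ²δ₂`
  and the plain `λ∣φ∣⁴` vertex); `V1_eq_sumWick4_sub_const` (AT PRINT'S `δ₁ = −4(N+2)C^ε_0(0)`: `V₁ = Σ_yη^d:∣φ(y)∣⁴: −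
  ∣T∣η^dN(N+2)C^ε_0(0)²` — the `:∣φ∣²:`-admixture of the plain vertex vanishes exactly at the solution of the `(0,1)` condition);
  `integral_sumWick4_massForm` (`∫W(Ση^d:∣φ∣⁴:)·Q = 0`: the mass vertex cannot close a vacuum graph with ONE Wick-ordered quartic
  vertex, BRICK 1 `integral_wick4_wick2`); `integral_sumWick4_cube` (`∫W(Ση^d:∣φ∣⁴:)³ = 64N(N+2)(N+8)·Z·Σ_{y₁,y₂,y₃}η^{3d}
  C(y₂,y₁)²C(y₃,y₁)²C(y₃,y₂)²`); and the headline **`iteratedDerivWithin_three_logZct_at_dm2One`: at print's `δm²_{(0,1)}` and ANY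
  `δm²_{(0,2)}`, `(∂/∂λ)³ log∫dφ e^{−S^ε}∣_{λ=0⁺} = −64N(N+2)(N+8)·Σ_{y₁,y₂,y₃}η^{3d}C^ε_0(y₂,y₁)²C^ε_0(y₃,y₁)²C^ε_0(y₃,y₂)²`** — the
  third cumulant of the Wick-ordered interaction is its third moment, the ONE connected vacuum graph with three Wick-ordered
  quartic vertices (every pair joined by two lines), and the covariance with the `(0,2)` mass vertex vanishes: the inserted
  `λ²δm²_{(0,2)}` does not enter this index (*"connected graphs without external legs"*); the same in (1.20)'s spelling
  (`iteratedDerivWithin_three_logZ_counterterm_at_dm2One`) and with print's prefactor `1/(0!3!)` and `λ³` (`E1_term_03_at_dm2One`: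
  the `(0,3)` term of `E₁` is `−(32/3)N(N+2)(N+8)λ³Σε^{3d}(C^ε_0)²(C^ε_0)²(C^ε_0)²`, print's picture = the triangle of three
  (1.6)-vertices with doubled lines, combinatoric factor DERIVED — *"we did not write … combinatoric factors before the graphs"*,
  p. 416).
* §6 EXTENSIVITY (`triangle_sum_eq_card_mul`, `iteratedDerivWithin_three_logZct_at_dm2One_eq_card_mul`): by translation invariance
  of `C^ε_0` the triangle sum is `∣T_ε∣` times a density independent of the base point — the per-volume normalization of part I's
  Theorem (1.14).

WITH BRICK 12 §10 (`(0,1)`, `(0,2)`) THIS CLOSES THE PURE-`λ` COLUMN `{(0,1), (0,2), (0,3)}` of p. 418's `2 ≦ α+2β ≦ 6` for (1.24),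
each derived from the measure at `e = 0` with print's counterterm series inserted and evaluated as connected vacuum graphs.

HONEST SCOPE.  (a) `e = 0` only: the indices with `α > 0` of weight ≤ 6 — `(2,0)` (BRICK 13), `(4,0)`, `(2,1)`, `(6,0)`, `(4,1)`,
`(2,2)` — are NOT touched here (`(4,0)`, `(2,1)` remain p26's typed bookkeeping / BRICK 14's two-point `(2,1)`; the vacuum `(2,1)`,
`(4,0)`, … are not in the tree).  (b) For GENERAL `δ₁` only the cumulant form is given; the graph expansion of `−κ₃(V₁) +
3δ₂Cov(V₁,Q)` for `δ₁ ≠ −4(N+2)C^ε_0(0)` (three more three-vertex families from the `:∣φ∣²:`-admixture — `⟨:φ⁴::φ⁴::φ²:⟩`,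
`⟨:φ⁴::φ²::φ²:⟩`, `⟨:φ²::φ²::φ²:⟩` — and the `δ₂`-bubble `⟨:φ²::φ²:⟩`) is not evaluated: print inserts ITS counterterms, and at
print's `δm²_{(0,1)}` all of them carry the vanishing coefficient `2(N+2)C^ε_0(0) + ½δm²_{(0,1)} = 0`.  (c) Finite torus at fixed
`ε = η`: nothing is uniform in `ε` and p. 418's *"the other terms are convergent as ε → 0"* is not touched.  (d) `λ ≥ 0`, one-sided,
throughout; BRICK 11's joint `(e,λ)`-smoothness is neither used nor restated.  (e) The identification with E₁'s `(0,3)` term reads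
(1.24) with the `λ`-derivative at `0⁺` (r01's `e1R`); the carrier-level decls of record (`ModelData.e1R`, `E1of124R`) are not
bridged to this concrete torus — an identification of readings, said here, not a theorem.  Mathlib + the cited tree files only.
VERSIONS: v1.0 p381120 ✓ 3e385e2c2a9c (gen 30); v1.1 (gen 31) = IMPORT SWAP — BRICK 12 `B3Eq123IndexZeroTwo` imported, v1.0's
§1 private copies of its moment calculus deleted; every v1.0 public statement byte-identical — plus ONE docstring locator
corrected (referee-1 N-ref1-g114-1: the *"vacuum graphs"* sentence is on p. 418, at `iteratedDerivWithin_three_logZct_at_dm2One`) and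
§3's Wick tools for products of Wick-ordered vertices made PUBLIC (were private in v1.0): `derivAlong_w3`, `derivAlong_P2`,
`derivAlong_P2'`, `integral_lin_w3`, `integral_w3_lin`, `integral_P2_mul`, `integral_P2_P2` — for the successor evaluating the
three-loop kernels of BRICK 17's `(2,2)` cumulants (two Wick-ordered vertices against ②/④/mass insertions).
-/

noncomputable section

open scoped BigOperators InnerProductSpace Topology

namespace Literature.MathematicalPhysics.QuantumFieldTheory.Balaban1983to89.B3Eq124IndexZeroThree

open _root_.MeasureTheory _root_.Filter
open LatticeFieldCalculus B3WT223Instance B3WTPropagator B3WTCovariance B3WickVertexCalculus B3Eq122FirstOrderWick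
  B3Eq123IndexZeroTwo

variable {P : Params} {j N : ℕ} (C : HiggsLattice.ChargeData N) (η w c m2 : ℝ)

/-! ## §0 Toolbox (file-local).  v1.1: the one-sided moment calculus of v1.0's §1 (`integrable_moment` … `moment_split`)
and three weight identities of §0 were PRIVATE statement-identical copies of BRICK 12 `B3Eq123IndexZeroTwo` §0–§3, whose
farm olean was unbuilt at v1.0's filing; BRICK 12 is built since 2026-08-24T17:3xZ and is now IMPORTED — those copies are
deleted, the names below resolve to BRICK 12's declarations.  Kept: small growth/positivity helpers private in BRICK 12. -/

omit C η w c m2 in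
/-- exponential-linear growth is a property of the function (pointwise-equal observables). [folklore] -/
private theorem expGrowth_congr {g g' : Cfg P j N → ℝ} (hg : ExpGrowth g) (heq : ∀ φ, g φ = g' φ) : ExpGrowth g' := by
  obtain rfl : g = g' := funext heq
  exact hg

omit C η w c m2 in
/-- powers of an observable of exponential-linear growth have exponential-linear growth. [folklore] -/
private theorem expGrowth_pow {g : Cfg P j N → ℝ} (hg : ExpGrowth g) (n : ℕ) : ExpGrowth (fun φ => g φ ^ n) := by
  induction n with
  | zero => exact expGrowth_congr (ExpGrowth.const 1) fun φ => by simp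
  | succ n ih => exact expGrowth_congr (ih.mul hg) fun φ => by rw [pow_succ]

omit C η c m2 in
/-- the mass term `Q = Σ_yη^d∣φ(y)∣²` is an observable of exponential-linear growth. (= BRICK 12 `expGrowth_V_add_massForm`.2;
private copy.) [cite: Balaban1983Higgs3, (1.20) p.416] -/
private theorem expGrowth_massForm' : ExpGrowth (fun φ : Cfg P j N => massForm w φ) := by
  have h := ExpGrowth.sum (Finset.univ : Finset (Site P j))
    (f := fun x (φ : Cfg P j N) => w * ‖φ x‖ ^ 2) fun x _ => (ExpGrowth.norm_sq_apply x).const_mul w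
  simpa only [massForm] using h

omit C η c m2 in
/-- the shifted interaction per unit `λ`, `V₁ = Σ_yη^d∣φ(y)∣⁴ + ½δ₁Σ_yη^d∣φ(y)∣²`, is an observable of exponential-linear growth.
(= BRICK 12 `expGrowth_V_add_massForm`.1; private copy.) [cite: Balaban1983Higgs3, (1.20) p.416] -/
private theorem expGrowth_V1 (δ₁ : ℝ) :
    ExpGrowth (fun φ : Cfg P j N => (∑ y : Site P j, w * ‖φ y‖ ^ 4) + 1 / 2 * δ₁ * massForm w φ) :=
  (expGrowth_V (P := P) (j := j) (N := N) w).add ((expGrowth_massForm' w).const_mul (1 / 2 * δ₁))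

omit C η c m2 in
/-- the shifted interaction per unit `λ` is bounded below: `Σ_yη^d(∣φ(y)∣⁴ + ½δ₁∣φ(y)∣²) ≥ −∣T∣η^dδ₁²/16`. (= BRICK 12's private
`neg_le_V_add_massForm`.) [cite: Balaban1983Higgs3, (1.20) p.416] -/
private theorem neg_le_V1 (hw : 0 ≤ w) (δ₁ : ℝ) (φ : Cfg P j N) :
    -(Fintype.card (Site P j) * w * (δ₁ ^ 2 / 16)) ≤ (∑ y : Site P j, w * ‖φ y‖ ^ 4) + 1 / 2 * δ₁ * massForm w φ := by
  unfold massForm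
  have hy : ∀ y : Site P j, -(w * (δ₁ ^ 2 / 16)) ≤ w * ‖φ y‖ ^ 4 + 1 / 2 * δ₁ * (w * ‖φ y‖ ^ 2) := fun y => by
    have h : 0 ≤ w * (‖φ y‖ ^ 2 + δ₁ / 4) ^ 2 := mul_nonneg hw (sq_nonneg _)
    nlinarith
  calc -(Fintype.card (Site P j) * w * (δ₁ ^ 2 / 16)) = ∑ _y : Site P j, -(w * (δ₁ ^ 2 / 16)) := by
        rw [Finset.sum_const, Finset.card_univ, nsmul_eq_mul]; ring
    _ ≤ ∑ y : Site P j, (w * ‖φ y‖ ^ 4 + 1 / 2 * δ₁ * (w * ‖φ y‖ ^ 2)) := Finset.sum_le_sum fun y _ => hy y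
    _ = (∑ y : Site P j, w * ‖φ y‖ ^ 4) + 1 / 2 * δ₁ * ∑ y : Site P j, w * ‖φ y‖ ^ 2 := by
        rw [Finset.sum_add_distrib, Finset.mul_sum]

omit C η w c in
/-- a window `0 < L ≤ 1` with `L∣κ∣ ≤ m²/4` exists for every `κ` (`m² > 0`). (= BRICK 12's private `exists_window`.) [folklore] -/
private theorem exists_window (hm : 0 < m2) (κ : ℝ) : ∃ L : ℝ, 0 < L ∧ L ≤ 1 ∧ L * |κ| ≤ m2 / 4 := by
  refine ⟨min 1 (m2 / (4 * (|κ| + 1))), lt_min zero_lt_one (by positivity), min_le_left _ _, ?_⟩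
  have hk : 0 ≤ |κ| := abs_nonneg κ
  have h1 : min 1 (m2 / (4 * (|κ| + 1))) * |κ| ≤ m2 / (4 * (|κ| + 1)) * |κ| :=
    mul_le_mul_of_nonneg_right (min_le_right _ _) hk
  have h2 : m2 / (4 * (|κ| + 1)) * |κ| ≤ m2 / 4 := by
    rw [div_mul_eq_mul_div, div_le_div_iff₀ (by positivity) (by positivity)]
    nlinarith
  exact h1.trans h2


section Moments

end Moments


/-! ## §2 THE THIRD RIGHT-DERIVATIVE OF `log N_1` AT `λ = 0⁺` — one-variable calculus on the window (`(log M)‴ = M‴/M −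
3M′M″/M² + 2M′³/M³`) fed with §1: `N_1′ = −[N_V + 2λκN_Q]`, `N_1″ = N_{V²} + 4λκN_{VQ} − 2κN_Q + 4λ²κ²N_{Q²}`,
`N_1‴(0⁺) = −∫WV³ + 6κ∫WVQ` -/

section ThirdOrder

omit C η w c m2 in
/-- **calculus lemma**: if `M > 0` has derivative `M′` within `[0,∞)` on `[0,L)`, `M′` has derivative `M″` there, and `M″` has the
right-derivative `c` at `0`, then the third derivative within `[0,∞)` of `log M` at `0`, in Mathlib's `iteratedDerivWithin`, is
`c/M(0) − 3M′(0)M″(0)/M(0)² + 2M′(0)³/M(0)³`. [folklore] -/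
private theorem iteratedDerivWithin_three_log {M M' M'' : ℝ → ℝ} {cc L : ℝ} (hL : 0 < L)
    (hpos : ∀ x : ℝ, 0 ≤ x → x < L → 0 < M x) (h1 : ∀ x : ℝ, 0 ≤ x → x < L → HasDerivWithinAt M (M' x) (Set.Ici 0) x)
    (h2 : ∀ x : ℝ, 0 ≤ x → x < L → HasDerivWithinAt M' (M'' x) (Set.Ici 0) x)
    (h3 : HasDerivWithinAt M'' cc (Set.Ici 0) 0) :
    iteratedDerivWithin 3 (fun x => Real.log (M x)) (Set.Ici 0) 0
      = cc / M 0 - 3 * M' 0 * M'' 0 / M 0 ^ 2 + 2 * M' 0 ^ 3 / M 0 ^ 3 := by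
  -- the first derivative within `[0,∞)` on the window
  have hA : ∀ x : ℝ, 0 ≤ x → x < L →
      HasDerivWithinAt (fun x => Real.log (M x)) (M' x / M x) (Set.Ici 0) x :=
    fun x hx0 hxL => (h1 x hx0 hxL).log (hpos x hx0 hxL).ne'
  have hB : ∀ x : ℝ, 0 ≤ x → x < L → derivWithin (fun x => Real.log (M x)) (Set.Ici 0) x = M' x / M x :=
    fun x hx0 hxL => (hA x hx0 hxL).derivWithin (uniqueDiffOn_Ici (0 : ℝ) x hx0)
  -- the second derivative within `[0,∞)` on the window
  have hC : ∀ x : ℝ, 0 ≤ x → x < L →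
      HasDerivWithinAt (fun x => M' x / M x) ((M'' x * M x - M' x * M' x) / M x ^ 2) (Set.Ici 0) x :=
    fun x hx0 hxL => (h2 x hx0 hxL).div (h1 x hx0 hxL) (hpos x hx0 hxL).ne'
  have hwin : ∀ x : ℝ, 0 ≤ x → x < L →
      derivWithin (fun x => Real.log (M x)) (Set.Ici 0) =ᶠ[𝓝[Set.Ici (0 : ℝ)] x] fun x => M' x / M x := by
    intro x hx0 hxL
    have hmem : Set.Ici (0 : ℝ) ∩ Set.Iio L ∈ 𝓝[Set.Ici (0 : ℝ)] x :=
      inter_mem self_mem_nhdsWithin (mem_nhdsWithin_of_mem_nhds (Iio_mem_nhds hxL))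
    exact Filter.eventually_of_mem hmem fun y hy => hB y hy.1 hy.2
  have hD : ∀ x : ℝ, 0 ≤ x → x < L →
      derivWithin (derivWithin (fun x => Real.log (M x)) (Set.Ici 0)) (Set.Ici 0) x
        = (M'' x * M x - M' x * M' x) / M x ^ 2 := by
    intro x hx0 hxL
    rw [(hwin x hx0 hxL).derivWithin_eq_of_mem (Set.mem_Ici.mpr hx0)]
    exact (hC x hx0 hxL).derivWithin (uniqueDiffOn_Ici (0 : ℝ) x hx0)
  -- the third derivative at `0`
  have hE : iteratedDerivWithin 2 (fun x => Real.log (M x)) (Set.Ici 0)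
      = fun x => derivWithin (derivWithin (fun x => Real.log (M x)) (Set.Ici 0)) (Set.Ici 0) x := by
    funext x
    rw [show (2 : ℕ) = 1 + 1 from rfl, iteratedDerivWithin_succ, iteratedDerivWithin_one]
  have hwin2 : (fun x => derivWithin (derivWithin (fun x => Real.log (M x)) (Set.Ici 0)) (Set.Ici 0) x)
      =ᶠ[𝓝[Set.Ici (0 : ℝ)] 0] fun x => (M'' x * M x - M' x * M' x) / M x ^ 2 := by
    filter_upwards [Ico_mem_nhdsGE hL] with x hx
    exact hD x hx.1 hx.2
  have h10 := h1 0 le_rfl hL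
  have h20 := h2 0 le_rfl hL
  have hM0 : M 0 ≠ 0 := (hpos 0 le_rfl hL).ne'
  have hF : HasDerivWithinAt (fun x => (M'' x * M x - M' x * M' x) / M x ^ 2)
      (((cc * M 0 + M'' 0 * M' 0 - (M'' 0 * M' 0 + M' 0 * M'' 0)) * M 0 ^ 2
        - (M'' 0 * M 0 - M' 0 * M' 0) * (2 * M 0 * M' 0)) / (M 0 ^ 2) ^ 2) (Set.Ici 0) 0 := by
    have hnum : HasDerivWithinAt (fun x => M'' x * M x - M' x * M' x)
        (cc * M 0 + M'' 0 * M' 0 - (M'' 0 * M' 0 + M' 0 * M'' 0)) (Set.Ici 0) 0 :=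
      (h3.fun_mul h10).fun_sub (h20.fun_mul h20)
    have hden : HasDerivWithinAt (fun x => M x ^ 2) (2 * M 0 * M' 0) (Set.Ici 0) 0 := by
      have h := h10.fun_pow 2
      refine h.congr_deriv ?_
      norm_num
    have h := hnum.fun_div hden (pow_ne_zero 2 hM0)
    refine h.congr_deriv ?_
    ring
  rw [iteratedDerivWithin_succ, hE, hwin2.derivWithin_eq_of_mem Set.self_mem_Ici,
    hF.derivWithin (uniqueDiffOn_Ici (0 : ℝ) 0 Set.self_mem_Ici)]
  field_simp
  ring

/-- **THE THIRD RIGHT-DERIVATIVE OF `log∫We^{−(λV+λ²κQ)}` AT `λ = 0⁺`, for every interaction `V ≥ −K` of exponential-linear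
growth and every `κ`**: in Mathlib's spelling,
`iteratedDerivWithin 3 (λ ↦ log∫We^{−(λV+λ²κQ)}) (Set.Ici 0) 0 = −κ₃(V) + 6κ·Cov(V,Q)`, the third cumulant
`κ₃(V) = E[V³] − 3E[V²]E[V] + 2E[V]³` and the covariance `Cov(V,Q) = E[VQ] − E[V]E[Q]` of the FREE field (`E = Z⁻¹∫W·`) — three
one-sided dominated differentiations (§1) and the calculus lemma above (`N_1‴(0⁺) = −∫WV³ + 6κ∫WVQ`, `N_1″(0) = ∫WV² − 2κ∫WQ`,
`N_1′(0) = −∫WV`). [cite: Balaban1983Higgs3, (1.24) p.417] [cite: GlimmJaffeQP1987, §8.4–8.5] -/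
theorem iteratedDerivWithin_three_logMoment (hw : 0 < w) (hm : 0 < m2) {V : Cfg P j N → ℝ} (hV : ExpGrowth V) {K : ℝ}
    (hK : 0 ≤ K) (hVK : ∀ φ, -K ≤ V φ) (κ : ℝ) :
    iteratedDerivWithin 3
        (fun lam : ℝ => Real.log (∫ φ, weight C η w c m2 (0 : VecField P j ℝ) φ * (Real.exp (-(lam * V φ + lam ^ 2 * (κ * massForm w φ))) * 1)))
        (Set.Ici 0) 0
      = -((∫ φ, weight C η w c m2 (0 : VecField P j ℝ) φ * V φ ^ 3) / (∫ φ, weight C η w c m2 (0 : VecField P j ℝ) φ)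
            - 3 * (∫ φ, weight C η w c m2 (0 : VecField P j ℝ) φ * V φ ^ 2) * (∫ φ, weight C η w c m2 (0 : VecField P j ℝ) φ * V φ) / (∫ φ, weight C η w c m2 (0 : VecField P j ℝ) φ) ^ 2
            + 2 * (∫ φ, weight C η w c m2 (0 : VecField P j ℝ) φ * V φ) ^ 3 / (∫ φ, weight C η w c m2 (0 : VecField P j ℝ) φ) ^ 3)
        + 6 * κ * ((∫ φ, weight C η w c m2 (0 : VecField P j ℝ) φ * (V φ * massForm w φ)) / (∫ φ, weight C η w c m2 (0 : VecField P j ℝ) φ)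
            - (∫ φ, weight C η w c m2 (0 : VecField P j ℝ) φ * V φ) * (∫ φ, weight C η w c m2 (0 : VecField P j ℝ) φ * massForm w φ) / (∫ φ, weight C η w c m2 (0 : VecField P j ℝ) φ) ^ 2) := by
  obtain ⟨L, hL0, hL1, hLκ⟩ := exists_window m2 hm κ
  have hQ := expGrowth_massForm' (P := P) (j := j) (N := N) w
  have h1g := ExpGrowth.const (P := P) (j := j) (N := N) (1 : ℝ)
  -- window bookkeeping
  have hwin : ∀ x : ℝ, 0 ≤ x → x < L → x ≤ 1 ∧ x * |κ| ≤ m2 / 4 := fun x hx0 hxL =>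
    ⟨hxL.le.trans hL1, (mul_le_mul_of_nonneg_right hxL.le (abs_nonneg κ)).trans hLκ⟩
  -- the moments as functions of `λ` (`E` = the exponential factor)
  set M : ℝ → ℝ := fun lam => ∫ φ, weight C η w c m2 (0 : VecField P j ℝ) φ * (Real.exp (-(lam * V φ + lam ^ 2 * (κ * massForm w φ))) * 1) with hMdef
  set MV : ℝ → ℝ := fun lam => ∫ φ, weight C η w c m2 (0 : VecField P j ℝ) φ * (Real.exp (-(lam * V φ + lam ^ 2 * (κ * massForm w φ))) * (V φ * 1))
    with hMVdef
  set MQ : ℝ → ℝ := fun lam =>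
    ∫ φ, weight C η w c m2 (0 : VecField P j ℝ) φ * (Real.exp (-(lam * V φ + lam ^ 2 * (κ * massForm w φ))) * (massForm w φ * 1)) with hMQdef
  set MVV : ℝ → ℝ := fun lam =>
    ∫ φ, weight C η w c m2 (0 : VecField P j ℝ) φ * (Real.exp (-(lam * V φ + lam ^ 2 * (κ * massForm w φ))) * (V φ * (V φ * 1))) with hMVVdef
  set MQV : ℝ → ℝ := fun lam =>
    ∫ φ, weight C η w c m2 (0 : VecField P j ℝ) φ * (Real.exp (-(lam * V φ + lam ^ 2 * (κ * massForm w φ))) * (massForm w φ * (V φ * 1))) with hMQVdef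
  set MVQ : ℝ → ℝ := fun lam =>
    ∫ φ, weight C η w c m2 (0 : VecField P j ℝ) φ * (Real.exp (-(lam * V φ + lam ^ 2 * (κ * massForm w φ))) * (V φ * (massForm w φ * 1))) with hMVQdef
  set MQQ : ℝ → ℝ := fun lam =>
    ∫ φ, weight C η w c m2 (0 : VecField P j ℝ) φ * (Real.exp (-(lam * V φ + lam ^ 2 * (κ * massForm w φ))) * (massForm w φ * (massForm w φ * 1)))
    with hMQQdef
  set M' : ℝ → ℝ := fun lam => -(MV lam + 2 * lam * κ * MQ lam) with hM'def
  set M'' : ℝ → ℝ := fun lam =>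
    (MVV lam + 2 * lam * κ * MQV lam) - 2 * κ * MQ lam + 2 * lam * κ * (MVQ lam + 2 * lam * κ * MQQ lam) with hM''def
  -- §1 on the window: the derivatives of the moments
  have dM : ∀ x : ℝ, 0 ≤ x → x < L → HasDerivWithinAt M (M' x) (Set.Ici 0) x := by
    intro x hx0 hxL
    have h := hasDerivWithinAt_moment C η w c m2 hw hm hV hK hVK h1g (κ := κ) hL1 hLκ hx0 hxL
    refine h.congr_deriv ?_
    rw [moment_split C η w c m2 hw hm hV hK hVK h1g hx0 (hwin x hx0 hxL).1 (hwin x hx0 hxL).2]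
  have dMV : ∀ x : ℝ, 0 ≤ x → x < L →
      HasDerivWithinAt MV (-(MVV x + 2 * x * κ * MQV x)) (Set.Ici 0) x := by
    intro x hx0 hxL
    have h := hasDerivWithinAt_moment C η w c m2 hw hm hV hK hVK (hV.mul h1g) (κ := κ) hL1 hLκ hx0 hxL
    refine h.congr_deriv ?_
    rw [moment_split C η w c m2 hw hm hV hK hVK (hV.mul h1g) hx0 (hwin x hx0 hxL).1 (hwin x hx0 hxL).2]
  have dMQ : ∀ x : ℝ, 0 ≤ x → x < L →
      HasDerivWithinAt MQ (-(MVQ x + 2 * x * κ * MQQ x)) (Set.Ici 0) x := by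
    intro x hx0 hxL
    have h := hasDerivWithinAt_moment C η w c m2 hw hm hV hK hVK (hQ.mul h1g) (κ := κ) hL1 hLκ hx0 hxL
    refine h.congr_deriv ?_
    rw [moment_split C η w c m2 hw hm hV hK hVK (hQ.mul h1g) hx0 (hwin x hx0 hxL).1 (hwin x hx0 hxL).2]
  have dM' : ∀ x : ℝ, 0 ≤ x → x < L → HasDerivWithinAt M' (M'' x) (Set.Ici 0) x := by
    intro x hx0 hxL
    have hlin : HasDerivWithinAt (fun lam : ℝ => 2 * lam * κ) (2 * κ) (Set.Ici 0) x := by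
      have h := ((hasDerivAt_id x).const_mul 2).mul_const κ
      simpa using h.hasDerivWithinAt
    have h := ((dMV x hx0 hxL).add (hlin.mul (dMQ x hx0 hxL))).neg
    refine h.congr_deriv ?_
    simp only [hM''def]
    ring
  -- the right-derivatives at `0` of the moments entering `M″`
  have dMVV0 := hasDerivWithinAt_moment_zero C η w c m2 hw hm hV hK hVK (hV.mul (hV.mul h1g)) (κ := κ) hL0 hL1 hLκ
  have dMQV0 := hasDerivWithinAt_moment_zero C η w c m2 hw hm hV hK hVK (hQ.mul (hV.mul h1g)) (κ := κ) hL0 hL1 hLκ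
  have dMQ0 := hasDerivWithinAt_moment_zero C η w c m2 hw hm hV hK hVK (hQ.mul h1g) (κ := κ) hL0 hL1 hLκ
  have dMVQ0 := hasDerivWithinAt_moment_zero C η w c m2 hw hm hV hK hVK (hV.mul (hQ.mul h1g)) (κ := κ) hL0 hL1 hLκ
  have dMQQ0 := hasDerivWithinAt_moment_zero C η w c m2 hw hm hV hK hVK (hQ.mul (hQ.mul h1g)) (κ := κ) hL0 hL1 hLκ
  have hlin0 : HasDerivWithinAt (fun lam : ℝ => 2 * lam * κ) (2 * κ) (Set.Ici 0) 0 := by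
    have h := ((hasDerivAt_id (0 : ℝ)).const_mul 2).mul_const κ
    simpa using h.hasDerivWithinAt
  have dM'' : HasDerivWithinAt M''
      (-(∫ φ, weight C η w c m2 (0 : VecField P j ℝ) φ * (V φ * (V φ * (V φ * 1)))) + 2 * κ * MQV 0
        - 2 * κ * (-(∫ φ, weight C η w c m2 (0 : VecField P j ℝ) φ * (V φ * (massForm w φ * 1)))) + 2 * κ * (MVQ 0 + 2 * 0 * κ * MQQ 0)) (Set.Ici 0) 0 := by
    have h := (((dMVV0.add (hlin0.mul dMQV0)).sub (dMQ0.const_mul (2 * κ))).add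
      (hlin0.mul (dMVQ0.add (hlin0.mul dMQQ0))))
    refine h.congr_deriv ?_
    simp only [Pi.add_apply, Pi.mul_apply]
    ring
  -- positivity and the values at `0`
  have hposM : ∀ x : ℝ, 0 ≤ x → x < L → 0 < M x := fun x hx0 hxL =>
    moment_one_pos C η w c m2 hw hm hV hK hVK (κ := κ) hx0 (hwin x hx0 hxL).1 (hwin x hx0 hxL).2
  have key := iteratedDerivWithin_three_log (M := M) (M' := M') (M'' := M'') hL0 hposM dM dM' dM''
  rw [key]
  -- evaluate everything at `λ = 0`
  have eM : M 0 = ∫ φ, weight C η w c m2 (0 : VecField P j ℝ) φ := by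
    simp only [hMdef]; rw [moment_zero]; simp only [mul_one]
  have eMV : MV 0 = ∫ φ, weight C η w c m2 (0 : VecField P j ℝ) φ * V φ := by
    simp only [hMVdef]; rw [moment_zero]; simp only [mul_one]
  have eMQ : MQ 0 = ∫ φ, weight C η w c m2 (0 : VecField P j ℝ) φ * massForm w φ := by
    simp only [hMQdef]; rw [moment_zero]; simp only [mul_one]
  have eMVV : MVV 0 = ∫ φ, weight C η w c m2 (0 : VecField P j ℝ) φ * V φ ^ 2 := by
    simp only [hMVVdef]; rw [moment_zero]
    exact integral_congr_ae (Filter.Eventually.of_forall fun φ => by simp only [mul_one]; ring)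
  have eMQV : MQV 0 = ∫ φ, weight C η w c m2 (0 : VecField P j ℝ) φ * (V φ * massForm w φ) := by
    simp only [hMQVdef]; rw [moment_zero]
    exact integral_congr_ae (Filter.Eventually.of_forall fun φ => by simp only [mul_one]; ring)
  have eMVQ : MVQ 0 = ∫ φ, weight C η w c m2 (0 : VecField P j ℝ) φ * (V φ * massForm w φ) := by
    simp only [hMVQdef]; rw [moment_zero]
    exact integral_congr_ae (Filter.Eventually.of_forall fun φ => by simp only [mul_one])
  have eV3 : (∫ φ, weight C η w c m2 (0 : VecField P j ℝ) φ * (V φ * (V φ * (V φ * 1)))) = ∫ φ, weight C η w c m2 (0 : VecField P j ℝ) φ * V φ ^ 3 :=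
    integral_congr_ae (Filter.Eventually.of_forall fun φ => by simp only [mul_one]; ring)
  have eVQ : (∫ φ, weight C η w c m2 (0 : VecField P j ℝ) φ * (V φ * (massForm w φ * 1))) = ∫ φ, weight C η w c m2 (0 : VecField P j ℝ) φ * (V φ * massForm w φ) :=
    integral_congr_ae (Filter.Eventually.of_forall fun φ => by simp only [mul_one])
  have eM' : M' 0 = -(∫ φ, weight C η w c m2 (0 : VecField P j ℝ) φ * V φ) := by
    simp only [hM'def]; rw [eMV]; ring
  have eM'' : M'' 0 = (∫ φ, weight C η w c m2 (0 : VecField P j ℝ) φ * V φ ^ 2) - 2 * κ * ∫ φ, weight C η w c m2 (0 : VecField P j ℝ) φ * massForm w φ := by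
    simp only [hM''def]; rw [eMVV, eMQ]; ring
  rw [eM, eM', eM'', eMQV, eMVQ, eV3, eVQ]
  have hZ : (∫ φ, weight C η w c m2 (0 : VecField P j ℝ) φ) ≠ 0 := (B3WT226Traces.Z_pos C η w c m2 hw hm).ne'
  field_simp
  ring

end ThirdOrder


/-! ## §3 WICK'S THEOREM FOR THREE WICK-ORDERED QUARTIC VERTICES: the Gaussian integrals the third cumulant needs -/

section WickTools

omit C η w c m2 in
/-- `⟪e_a, e_b⟫ = δ_{ab}`. [folklore] -/
private theorem inner_basis (a b : Fin N) : ⟪(EuclideanSpace.basisFun (Fin N) ℝ) a, (EuclideanSpace.basisFun (Fin N) ℝ) b⟫_ℝ = if a = b then 1 else 0 := by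
  classical
  exact orthonormal_iff_ite.mp (EuclideanSpace.basisFun (Fin N) ℝ).orthonormal a b

omit C η w c m2 in
/-- `⟪e_a, e_a⟫ = 1`. [folklore] -/
private theorem inner_basis_self (a : Fin N) : ⟪(EuclideanSpace.basisFun (Fin N) ℝ) a, (EuclideanSpace.basisFun (Fin N) ℝ) a⟫_ℝ = 1 := by
  rw [inner_basis, if_pos rfl]

omit C η w c m2 in
/-- `Σ_{i,k}⟪e_k,e_i⟫² = N`. [folklore] -/
private theorem sum_sum_inner_basis_sq : ∑ i : Fin N, ∑ k : Fin N, ⟪(EuclideanSpace.basisFun (Fin N) ℝ) k, (EuclideanSpace.basisFun (Fin N) ℝ) i⟫_ℝ ^ 2 = N := by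
  classical
  have e : ∀ i k : Fin N, ⟪(EuclideanSpace.basisFun (Fin N) ℝ) k, (EuclideanSpace.basisFun (Fin N) ℝ) i⟫_ℝ ^ 2 = if k = i then 1 else 0 := fun i k => by
    rw [inner_basis]; split_ifs <;> simp
  simp_rw [e, Finset.sum_ite_eq', if_pos (Finset.mem_univ _), Finset.sum_const, Finset.card_univ, Fintype.card_fin,
    nsmul_eq_mul, mul_one]

/-- linearity of the Gaussian integral on two observables of exponential-linear growth (bookkeeping helper).
[cite: GlimmJaffeQP1987, §8.3] -/
private theorem integral_W_add (hw : 0 < w) (hm : 0 < m2) {g₁ g₂ : Cfg P j N → ℝ} (h₁ : ExpGrowth g₁)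
    (h₂ : ExpGrowth g₂) : ∫ φ, weight C η w c m2 (0 : VecField P j ℝ) φ * (g₁ φ + g₂ φ) = (∫ φ, weight C η w c m2 (0 : VecField P j ℝ) φ * g₁ φ) + ∫ φ, weight C η w c m2 (0 : VecField P j ℝ) φ * g₂ φ := by
  have e : (fun φ : Cfg P j N => weight C η w c m2 (0 : VecField P j ℝ) φ * (g₁ φ + g₂ φ)) = fun φ => weight C η w c m2 (0 : VecField P j ℝ) φ * g₁ φ + weight C η w c m2 (0 : VecField P j ℝ) φ * g₂ φ := by funext φ; ring
  rw [e, integral_add (h₁.integrable C η w c m2 hw hm) (h₂.integrable C η w c m2 hw hm)]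

/-- pulling a constant out (bookkeeping helper). [cite: GlimmJaffeQP1987, §8.3] -/
private theorem integral_W_const_mul (r : ℝ) (g : Cfg P j N → ℝ) :
    ∫ φ, weight C η w c m2 (0 : VecField P j ℝ) φ * (r * g φ) = r * ∫ φ, weight C η w c m2 (0 : VecField P j ℝ) φ * g φ := by
  rw [← integral_const_mul]
  exact integral_congr_ae (Filter.Eventually.of_forall fun φ => by ring)

omit C η in
/-- the Wick-ordered cubic `:φ_k∣φ∣²:(z) = φ_k(z)(∣φ(z)∣² − (N+2)C(z,z))` differentiated along `h_{y,m}`: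
`D_{y,m}:φ_k∣φ∣²:(z) = C(z,y)[δ_{mk}(∣φ(z)∣² − (N+2)C(z,z)) + 2φ_k(z)φ_m(z)]` (BRICK 1's `derivAlong_wick4_1k` without the
vertex prefactor). [cite: GlimmJaffeQP1987, Prop. 8.3.1] -/
theorem derivAlong_w3 (y z : Site P j) (k m : Fin N) :
    DerivAlong (hx w c m2 y m) (fun φ : Cfg P j N => ⟪φ z, (EuclideanSpace.basisFun (Fin N) ℝ) k⟫_ℝ * (‖φ z‖ ^ 2 - (N + 2) * G w c m2 z z))
      (fun φ => G w c m2 z y *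
        (⟪(EuclideanSpace.basisFun (Fin N) ℝ) m, (EuclideanSpace.basisFun (Fin N) ℝ) k⟫_ℝ * (‖φ z‖ ^ 2 - (N + 2) * G w c m2 z z) + 2 * (⟪φ z, (EuclideanSpace.basisFun (Fin N) ℝ) k⟫_ℝ * ⟪φ z, (EuclideanSpace.basisFun (Fin N) ℝ) m⟫_ℝ))) := by
  have nsq := DerivAlong.norm_sq_apply (hx w c m2 y m) z
  have hin := DerivAlong.inner_apply (hx w c m2 y m) z ((EuclideanSpace.basisFun (Fin N) ℝ) k)
  exact (hin.mul (nsq.sub (DerivAlong.const _ _))).congr fun φ => by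
    rw [inner_hx_right, inner_hx_left]; ring

omit C η in
/-- the Wick-ordered quadratic remainder `P₂(z;i,k) = δ_{ki}(∣φ(z)∣² − (N+2)C(z,z)) + 2φ_i(z)φ_k(z)` differentiated along `h_{y,m}`:
`D_{y,m}P₂ = C(z,y)[2δ_{ki}φ_m(z) + 2(δ_{mi}φ_k(z) + φ_i(z)δ_{mk})]`. [cite: GlimmJaffeQP1987, Prop. 8.3.1] -/
theorem derivAlong_P2 (y z : Site P j) (i k m : Fin N) :
    DerivAlong (hx w c m2 y m)
      (fun φ : Cfg P j N => ⟪(EuclideanSpace.basisFun (Fin N) ℝ) k, (EuclideanSpace.basisFun (Fin N) ℝ) i⟫_ℝ * (‖φ z‖ ^ 2 - (N + 2) * G w c m2 z z) + 2 * (⟪φ z, (EuclideanSpace.basisFun (Fin N) ℝ) i⟫_ℝ * ⟪φ z, (EuclideanSpace.basisFun (Fin N) ℝ) k⟫_ℝ))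
      (fun φ => G w c m2 z y * (2 * ⟪(EuclideanSpace.basisFun (Fin N) ℝ) k, (EuclideanSpace.basisFun (Fin N) ℝ) i⟫_ℝ * ⟪φ z, (EuclideanSpace.basisFun (Fin N) ℝ) m⟫_ℝ
        + 2 * (⟪(EuclideanSpace.basisFun (Fin N) ℝ) m, (EuclideanSpace.basisFun (Fin N) ℝ) i⟫_ℝ * ⟪φ z, (EuclideanSpace.basisFun (Fin N) ℝ) k⟫_ℝ + ⟪φ z, (EuclideanSpace.basisFun (Fin N) ℝ) i⟫_ℝ * ⟪(EuclideanSpace.basisFun (Fin N) ℝ) m, (EuclideanSpace.basisFun (Fin N) ℝ) k⟫_ℝ))) := by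
  have nsq := DerivAlong.norm_sq_apply (hx w c m2 y m) z
  have hi := DerivAlong.inner_apply (hx w c m2 y m) z ((EuclideanSpace.basisFun (Fin N) ℝ) i)
  have hk := DerivAlong.inner_apply (hx w c m2 y m) z ((EuclideanSpace.basisFun (Fin N) ℝ) k)
  exact ((((nsq.sub (DerivAlong.const _ _)).const_mul _)).add ((hi.mul hk).const_mul 2)).congr fun φ => by
    rw [inner_hx_right, inner_hx_left, inner_hx_left]; ring

omit C η in
/-- and once more: `D_{y,n}D_{y,m}P₂(z;i,k) = 2C(z,y)²[δ_{ki}δ_{nm} + δ_{mi}δ_{nk} + δ_{ni}δ_{mk}]`, a constant.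
[cite: GlimmJaffeQP1987, Prop. 8.3.1] -/
theorem derivAlong_P2' (y z : Site P j) (i k m n : Fin N) :
    DerivAlong (hx w c m2 y n)
      (fun φ : Cfg P j N => G w c m2 z y * (2 * ⟪(EuclideanSpace.basisFun (Fin N) ℝ) k, (EuclideanSpace.basisFun (Fin N) ℝ) i⟫_ℝ * ⟪φ z, (EuclideanSpace.basisFun (Fin N) ℝ) m⟫_ℝ
        + 2 * (⟪(EuclideanSpace.basisFun (Fin N) ℝ) m, (EuclideanSpace.basisFun (Fin N) ℝ) i⟫_ℝ * ⟪φ z, (EuclideanSpace.basisFun (Fin N) ℝ) k⟫_ℝ + ⟪φ z, (EuclideanSpace.basisFun (Fin N) ℝ) i⟫_ℝ * ⟪(EuclideanSpace.basisFun (Fin N) ℝ) m, (EuclideanSpace.basisFun (Fin N) ℝ) k⟫_ℝ)))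
      (fun _ => 2 * G w c m2 z y ^ 2 *
        (⟪(EuclideanSpace.basisFun (Fin N) ℝ) k, (EuclideanSpace.basisFun (Fin N) ℝ) i⟫_ℝ * ⟪(EuclideanSpace.basisFun (Fin N) ℝ) n, (EuclideanSpace.basisFun (Fin N) ℝ) m⟫_ℝ + ⟪(EuclideanSpace.basisFun (Fin N) ℝ) m, (EuclideanSpace.basisFun (Fin N) ℝ) i⟫_ℝ * ⟪(EuclideanSpace.basisFun (Fin N) ℝ) n, (EuclideanSpace.basisFun (Fin N) ℝ) k⟫_ℝ + ⟪(EuclideanSpace.basisFun (Fin N) ℝ) n, (EuclideanSpace.basisFun (Fin N) ℝ) i⟫_ℝ * ⟪(EuclideanSpace.basisFun (Fin N) ℝ) m, (EuclideanSpace.basisFun (Fin N) ℝ) k⟫_ℝ)) := by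
  have hm' := DerivAlong.inner_apply (hx w c m2 y n) z ((EuclideanSpace.basisFun (Fin N) ℝ) m)
  have hi := DerivAlong.inner_apply (hx w c m2 y n) z ((EuclideanSpace.basisFun (Fin N) ℝ) i)
  have hk := DerivAlong.inner_apply (hx w c m2 y n) z ((EuclideanSpace.basisFun (Fin N) ℝ) k)
  exact (((hm'.const_mul _).add (((hk.const_mul _).add (hi.mul (DerivAlong.const _ _))).const_mul 2)).const_mul
    _).congr fun φ => by
    rw [inner_hx_left, inner_hx_left, inner_hx_left]; ring

/-- **a leg against a Wick-ordered cubic vanishes**: `∫W φ_m(z)·:φ_k∣φ∣²:(z′) = 0` — contracting the leg into the cubic leaves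
the Wick-ordered quadratic remainder, of mean zero (BRICK 1 `integral_wick4_rem2`). [cite: GlimmJaffeQP1987, Cor. 8.3.2] -/
theorem integral_lin_w3 (hw : 0 < w) (hm : 0 < m2) (z z' : Site P j) (m k : Fin N) :
    ∫ φ, weight C η w c m2 (0 : VecField P j ℝ) φ * (⟪φ z, (EuclideanSpace.basisFun (Fin N) ℝ) m⟫_ℝ * (⟪φ z', (EuclideanSpace.basisFun (Fin N) ℝ) k⟫_ℝ * (‖φ z'‖ ^ 2 - (N + 2) * G w c m2 z' z'))) = 0 := by
  have hg : ExpGrowth (fun φ : Cfg P j N => ⟪φ z', (EuclideanSpace.basisFun (Fin N) ℝ) k⟫_ℝ * (‖φ z'‖ ^ 2 - (N + 2) * G w c m2 z' z')) :=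
    (ExpGrowth.inner_apply z' _).mul ((ExpGrowth.norm_sq_apply z').sub (ExpGrowth.const _))
  have hg' : ExpGrowth (fun φ : Cfg P j N => G w c m2 z' z *
      (⟪(EuclideanSpace.basisFun (Fin N) ℝ) m, (EuclideanSpace.basisFun (Fin N) ℝ) k⟫_ℝ * (‖φ z'‖ ^ 2 - (N + 2) * G w c m2 z' z') + 2 * (⟪φ z', (EuclideanSpace.basisFun (Fin N) ℝ) k⟫_ℝ * ⟪φ z', (EuclideanSpace.basisFun (Fin N) ℝ) m⟫_ℝ))) :=
    ((((ExpGrowth.norm_sq_apply z').sub (ExpGrowth.const _)).const_mul _).add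
      (((ExpGrowth.inner_apply z' _).mul (ExpGrowth.inner_apply z' _)).const_mul 2)).const_mul _
  rw [ibp_site C η w c m2 hw hm z m hg hg' (derivAlong_w3 w c m2 z z' k m), integral_W_const_mul,
    integral_wick4_rem2 C η w c m2 hw hm z' k m, mul_zero]

/-- the mirror statement `∫W :φ_k∣φ∣²:(z)·φ_m(z′) = 0`. [cite: GlimmJaffeQP1987, Cor. 8.3.2] -/
theorem integral_w3_lin (hw : 0 < w) (hm : 0 < m2) (z z' : Site P j) (k m : Fin N) :
    ∫ φ, weight C η w c m2 (0 : VecField P j ℝ) φ * ((⟪φ z, (EuclideanSpace.basisFun (Fin N) ℝ) k⟫_ℝ * (‖φ z‖ ^ 2 - (N + 2) * G w c m2 z z)) * ⟪φ z', (EuclideanSpace.basisFun (Fin N) ℝ) m⟫_ℝ) = 0 := by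
  have h := integral_lin_w3 C η w c m2 hw hm z' z m k
  rw [← h]
  exact integral_congr_ae (Filter.Eventually.of_forall fun φ => by ring)

/-- **THE CONTRACTION RULE FOR THE WICK-ORDERED QUADRATIC REMAINDER**: for
`P₂(z;i,k) = δ_{ki}(∣φ(z)∣² − (N+2)C(z,z)) + 2φ_i(z)φ_k(z)` (= `δ_{ki}:∣φ(z)∣²: + 2:φ_iφ_k:(z)`),
`∫W P₂(z;i,k)·R = δ_{ki}[(N − (N+2))C(z,z)∫W R + Σ_a∫W D²_{z,a}R] + 2[C(z,z)δ_{ik}∫W R + ∫W D_{z,k}D_{z,i}R]` — both legs into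
`R` (the self-line terms cancel when `∫W R` is Wick-trivial). [cite: GlimmJaffeQP1987, Prop. 8.3.1, Cor. 8.3.2] -/
theorem integral_P2_mul (hw : 0 < w) (hm : 0 < m2) (z : Site P j) (i k : Fin N) {R : Cfg P j N → ℝ}
    {R₁ R₂ : Fin N → Cfg P j N → ℝ} {Rik : Cfg P j N → ℝ}
    (hR : ExpGrowth R) (hR₁ : ∀ a, ExpGrowth (R₁ a)) (hR₂ : ∀ a, ExpGrowth (R₂ a)) (hRik : ExpGrowth Rik)
    (hD₁ : ∀ a, DerivAlong (hx w c m2 z a) R (R₁ a)) (hD₂ : ∀ a, DerivAlong (hx w c m2 z a) (R₁ a) (R₂ a))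
    (hDik : DerivAlong (hx w c m2 z k) (R₁ i) Rik) :
    ∫ φ, weight C η w c m2 (0 : VecField P j ℝ) φ * ((⟪(EuclideanSpace.basisFun (Fin N) ℝ) k, (EuclideanSpace.basisFun (Fin N) ℝ) i⟫_ℝ * (‖φ z‖ ^ 2 - (N + 2) * G w c m2 z z) + 2 * (⟪φ z, (EuclideanSpace.basisFun (Fin N) ℝ) i⟫_ℝ * ⟪φ z, (EuclideanSpace.basisFun (Fin N) ℝ) k⟫_ℝ)) * R φ)
      = ⟪(EuclideanSpace.basisFun (Fin N) ℝ) k, (EuclideanSpace.basisFun (Fin N) ℝ) i⟫_ℝ * ((N * G w c m2 z z - (N + 2) * G w c m2 z z) * (∫ φ, weight C η w c m2 (0 : VecField P j ℝ) φ * R φ) + ∑ a : Fin N, ∫ φ, weight C η w c m2 (0 : VecField P j ℝ) φ * R₂ a φ)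
        + 2 * (G w c m2 z z * ⟪(EuclideanSpace.basisFun (Fin N) ℝ) i, (EuclideanSpace.basisFun (Fin N) ℝ) k⟫_ℝ * (∫ φ, weight C η w c m2 (0 : VecField P j ℝ) φ * R φ) + ∫ φ, weight C η w c m2 (0 : VecField P j ℝ) φ * Rik φ) := by
  -- the `∣φ(z)∣²R` part: `B3WickVertexCalculus.integral_norm_sq_mul`
  have hsq := integral_norm_sq_mul C η w c m2 hw hm z hR hR₁ hR₂ hD₁ hD₂
  -- the `φ_iφ_kR` part: two integrations by parts
  have hik : ∫ φ, weight C η w c m2 (0 : VecField P j ℝ) φ * (⟪φ z, (EuclideanSpace.basisFun (Fin N) ℝ) i⟫_ℝ * (⟪φ z, (EuclideanSpace.basisFun (Fin N) ℝ) k⟫_ℝ * R φ))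
      = G w c m2 z z * ⟪(EuclideanSpace.basisFun (Fin N) ℝ) i, (EuclideanSpace.basisFun (Fin N) ℝ) k⟫_ℝ * (∫ φ, weight C η w c m2 (0 : VecField P j ℝ) φ * R φ) + ∫ φ, weight C η w c m2 (0 : VecField P j ℝ) φ * Rik φ := by
    have hg : ExpGrowth (fun φ : Cfg P j N => ⟪φ z, (EuclideanSpace.basisFun (Fin N) ℝ) k⟫_ℝ * R φ) := (ExpGrowth.inner_apply z _).mul hR
    have hg' : ExpGrowth (fun φ : Cfg P j N => G w c m2 z z * ⟪(EuclideanSpace.basisFun (Fin N) ℝ) i, (EuclideanSpace.basisFun (Fin N) ℝ) k⟫_ℝ * R φ + ⟪φ z, (EuclideanSpace.basisFun (Fin N) ℝ) k⟫_ℝ * R₁ i φ) :=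
      ((hR.const_mul _)).add ((ExpGrowth.inner_apply z _).mul (hR₁ i))
    have hD : DerivAlong (hx w c m2 z i) (fun φ : Cfg P j N => ⟪φ z, (EuclideanSpace.basisFun (Fin N) ℝ) k⟫_ℝ * R φ)
        (fun φ => G w c m2 z z * ⟪(EuclideanSpace.basisFun (Fin N) ℝ) i, (EuclideanSpace.basisFun (Fin N) ℝ) k⟫_ℝ * R φ + ⟪φ z, (EuclideanSpace.basisFun (Fin N) ℝ) k⟫_ℝ * R₁ i φ) :=
      ((DerivAlong.inner_apply (hx w c m2 z i) z ((EuclideanSpace.basisFun (Fin N) ℝ) k)).mul (hD₁ i)).congr fun φ => by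
        rw [inner_hx_left]
    rw [ibp_site C η w c m2 hw hm z i hg hg' hD, integral_W_add C η w c m2 hw hm (hR.const_mul _)
      ((ExpGrowth.inner_apply z _).mul (hR₁ i)), integral_W_const_mul,
      ibp_site C η w c m2 hw hm z k (hR₁ i) hRik hDik]
  have e : (fun φ : Cfg P j N => weight C η w c m2 (0 : VecField P j ℝ) φ * ((⟪(EuclideanSpace.basisFun (Fin N) ℝ) k, (EuclideanSpace.basisFun (Fin N) ℝ) i⟫_ℝ * (‖φ z‖ ^ 2 - (N + 2) * G w c m2 z z)
      + 2 * (⟪φ z, (EuclideanSpace.basisFun (Fin N) ℝ) i⟫_ℝ * ⟪φ z, (EuclideanSpace.basisFun (Fin N) ℝ) k⟫_ℝ)) * R φ)) = fun φ =>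
      weight C η w c m2 (0 : VecField P j ℝ) φ * (⟪(EuclideanSpace.basisFun (Fin N) ℝ) k, (EuclideanSpace.basisFun (Fin N) ℝ) i⟫_ℝ * (‖φ z‖ ^ 2 * R φ) + (-(⟪(EuclideanSpace.basisFun (Fin N) ℝ) k, (EuclideanSpace.basisFun (Fin N) ℝ) i⟫_ℝ * ((N + 2) * G w c m2 z z)) * R φ
        + 2 * (⟪φ z, (EuclideanSpace.basisFun (Fin N) ℝ) i⟫_ℝ * (⟪φ z, (EuclideanSpace.basisFun (Fin N) ℝ) k⟫_ℝ * R φ)))) := by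
    funext φ; ring
  rw [e, integral_W_add C η w c m2 hw hm (((ExpGrowth.norm_sq_apply z).mul hR).const_mul _)
    ((hR.const_mul _).add ((((ExpGrowth.inner_apply z _).mul ((ExpGrowth.inner_apply z _).mul hR))).const_mul 2)),
    integral_W_add C η w c m2 hw hm (hR.const_mul _) (((ExpGrowth.inner_apply z _).mul
      ((ExpGrowth.inner_apply z _).mul hR)).const_mul 2),
    integral_W_const_mul, integral_W_const_mul, integral_W_const_mul, hsq, hik]
  ring

/-- **THE TWO-LINE KERNEL BETWEEN TWO QUADRATIC REMAINDERS** (`v = C(z′,z)`):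
`∫W P₂(z;i,k)·P₂(z′;m,n) = 2v²·Z·[(N+4)δ_{ki}δ_{nm} + 2(δ_{mi}δ_{nk} + δ_{ni}δ_{mk})]` — i.e.
`⟨:∣φ(z)∣²::∣φ(z′)∣²:⟩ = 2Nv²`, `⟨:∣φ(z)∣²: :φ_mφ_n:(z′)⟩ = 2v²δ_{mn}`, `⟨:φ_iφ_k:(z):φ_mφ_n:(z′)⟩ = v²(δ_{im}δ_{kn} + δ_{in}δ_{km})`
combined. [cite: GlimmJaffeQP1987, Prop. 8.3.1, Cor. 8.3.2] -/
theorem integral_P2_P2 (hw : 0 < w) (hm : 0 < m2) (z z' : Site P j) (i k m n : Fin N) :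
    ∫ φ, weight C η w c m2 (0 : VecField P j ℝ) φ * ((⟪(EuclideanSpace.basisFun (Fin N) ℝ) k, (EuclideanSpace.basisFun (Fin N) ℝ) i⟫_ℝ * (‖φ z‖ ^ 2 - (N + 2) * G w c m2 z z) + 2 * (⟪φ z, (EuclideanSpace.basisFun (Fin N) ℝ) i⟫_ℝ * ⟪φ z, (EuclideanSpace.basisFun (Fin N) ℝ) k⟫_ℝ))
        * (⟪(EuclideanSpace.basisFun (Fin N) ℝ) n, (EuclideanSpace.basisFun (Fin N) ℝ) m⟫_ℝ * (‖φ z'‖ ^ 2 - (N + 2) * G w c m2 z' z') + 2 * (⟪φ z', (EuclideanSpace.basisFun (Fin N) ℝ) m⟫_ℝ * ⟪φ z', (EuclideanSpace.basisFun (Fin N) ℝ) n⟫_ℝ)))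
      = 2 * G w c m2 z' z ^ 2 * (∫ φ, weight C η w c m2 (0 : VecField P j ℝ) φ) *
          ((N + 4) * (⟪(EuclideanSpace.basisFun (Fin N) ℝ) k, (EuclideanSpace.basisFun (Fin N) ℝ) i⟫_ℝ * ⟪(EuclideanSpace.basisFun (Fin N) ℝ) n, (EuclideanSpace.basisFun (Fin N) ℝ) m⟫_ℝ) + 2 * (⟪(EuclideanSpace.basisFun (Fin N) ℝ) i, (EuclideanSpace.basisFun (Fin N) ℝ) m⟫_ℝ * ⟪(EuclideanSpace.basisFun (Fin N) ℝ) k, (EuclideanSpace.basisFun (Fin N) ℝ) n⟫_ℝ + ⟪(EuclideanSpace.basisFun (Fin N) ℝ) k, (EuclideanSpace.basisFun (Fin N) ℝ) m⟫_ℝ * ⟪(EuclideanSpace.basisFun (Fin N) ℝ) i, (EuclideanSpace.basisFun (Fin N) ℝ) n⟫_ℝ)) := by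
  -- `R = P₂(z′;m,n)` and its contractions along `h_{z,a}` (`derivAlong_P2`, `derivAlong_P2'`)
  have hR : ExpGrowth (fun φ : Cfg P j N =>
      ⟪(EuclideanSpace.basisFun (Fin N) ℝ) n, (EuclideanSpace.basisFun (Fin N) ℝ) m⟫_ℝ * (‖φ z'‖ ^ 2 - (N + 2) * G w c m2 z' z') + 2 * (⟪φ z', (EuclideanSpace.basisFun (Fin N) ℝ) m⟫_ℝ * ⟪φ z', (EuclideanSpace.basisFun (Fin N) ℝ) n⟫_ℝ)) :=
    ((((ExpGrowth.norm_sq_apply z').sub (ExpGrowth.const _)).const_mul _)).add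
      (((ExpGrowth.inner_apply z' _).mul (ExpGrowth.inner_apply z' _)).const_mul 2)
  have hR₁ : ∀ a : Fin N, ExpGrowth (fun φ : Cfg P j N => G w c m2 z' z * (2 * ⟪(EuclideanSpace.basisFun (Fin N) ℝ) n, (EuclideanSpace.basisFun (Fin N) ℝ) m⟫_ℝ * ⟪φ z', (EuclideanSpace.basisFun (Fin N) ℝ) a⟫_ℝ
      + 2 * (⟪(EuclideanSpace.basisFun (Fin N) ℝ) a, (EuclideanSpace.basisFun (Fin N) ℝ) m⟫_ℝ * ⟪φ z', (EuclideanSpace.basisFun (Fin N) ℝ) n⟫_ℝ + ⟪φ z', (EuclideanSpace.basisFun (Fin N) ℝ) m⟫_ℝ * ⟪(EuclideanSpace.basisFun (Fin N) ℝ) a, (EuclideanSpace.basisFun (Fin N) ℝ) n⟫_ℝ))) := fun a =>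
    (((ExpGrowth.inner_apply z' _).const_mul _).add ((((ExpGrowth.inner_apply z' _).const_mul _).add
      ((ExpGrowth.inner_apply z' _).mul (ExpGrowth.const _))).const_mul 2)).const_mul _
  have key := integral_P2_mul C η w c m2 hw hm z i k hR hR₁ (fun a => ExpGrowth.const _) (ExpGrowth.const _)
    (fun a => derivAlong_P2 w c m2 z z' m n a) (fun a => derivAlong_P2' w c m2 z z' m n a a)
    (derivAlong_P2' w c m2 z z' m n i k)
  have hS : ∑ a : Fin N, 2 * G w c m2 z' z ^ 2 *
      (⟪(EuclideanSpace.basisFun (Fin N) ℝ) n, (EuclideanSpace.basisFun (Fin N) ℝ) m⟫_ℝ * ⟪(EuclideanSpace.basisFun (Fin N) ℝ) a, (EuclideanSpace.basisFun (Fin N) ℝ) a⟫_ℝ + ⟪(EuclideanSpace.basisFun (Fin N) ℝ) a, (EuclideanSpace.basisFun (Fin N) ℝ) m⟫_ℝ * ⟪(EuclideanSpace.basisFun (Fin N) ℝ) a, (EuclideanSpace.basisFun (Fin N) ℝ) n⟫_ℝ + ⟪(EuclideanSpace.basisFun (Fin N) ℝ) a, (EuclideanSpace.basisFun (Fin N)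 ℝ) m⟫_ℝ * ⟪(EuclideanSpace.basisFun (Fin N) ℝ) a, (EuclideanSpace.basisFun (Fin N) ℝ) n⟫_ℝ)
      = 2 * G w c m2 z' z ^ 2 * ((N + 2) * ⟪(EuclideanSpace.basisFun (Fin N) ℝ) n, (EuclideanSpace.basisFun (Fin N) ℝ) m⟫_ℝ) := by
    classical
    have e : ∀ a : Fin N, ⟪(EuclideanSpace.basisFun (Fin N) ℝ) n, (EuclideanSpace.basisFun (Fin N) ℝ) m⟫_ℝ * ⟪(EuclideanSpace.basisFun (Fin N) ℝ) a, (EuclideanSpace.basisFun (Fin N) ℝ) a⟫_ℝ + ⟪(EuclideanSpace.basisFun (Fin N) ℝ) a, (EuclideanSpace.basisFun (Fin N) ℝ) m⟫_ℝ * ⟪(EuclideanSpace.basisFun (Fin N) ℝ) a, (EuclideanSpace.basisFun (Fin N) ℝ) n⟫_ℝ + ⟪(EuclideanSpace.basisFun (Fin N) ℝ) a, (EuclideanSpace.basisFun (Fin N) ℝ) m⟫_ℝ * ⟪(EuclideanSpace.basisFun (Fin N) ℝ) a, (EuclideanSpace.basisFun (Fin N) ℝ) n⟫_ℝ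
        = ⟪(EuclideanSpace.basisFun (Fin N) ℝ) n, (EuclideanSpace.basisFun (Fin N) ℝ) m⟫_ℝ + 2 * (if a = m then ⟪(EuclideanSpace.basisFun (Fin N) ℝ) a, (EuclideanSpace.basisFun (Fin N) ℝ) n⟫_ℝ else 0) := fun a => by
      rw [inner_basis_self, inner_basis a m]; split_ifs <;> ring
    rw [← Finset.mul_sum]
    simp_rw [e]
    rw [Finset.sum_add_distrib, Finset.sum_const, Finset.card_univ, Fintype.card_fin, nsmul_eq_mul, ← Finset.mul_sum,
      Finset.sum_ite_eq' Finset.univ m, if_pos (Finset.mem_univ _), real_inner_comm ((EuclideanSpace.basisFun (Fin N) ℝ) n) ((EuclideanSpace.basisFun (Fin N) ℝ) m)]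
    ring
  rw [key, integral_wick4_rem2 C η w c m2 hw hm z' m n]
  simp_rw [integral_mul_const]
  rw [← Finset.mul_sum, hS]
  ring

end WickTools


/-! ## §4 THE TRIANGLE WITH DOUBLED LINES: `∫W:∣φ(y)∣⁴::∣φ(z)∣⁴::∣φ(z′)∣⁴: = 64N(N+2)(N+8)·C(z,y)²C(z′,y)²C(z′,z)²·Z` — the one
vacuum graph with three Wick-ordered quartic vertices (each pair of vertices joined by exactly two lines) -/

section Triangle

/-- **WICK'S THEOREM FOR THREE WICK-ORDERED QUARTIC VERTICES (the vacuum triangle with doubled lines)**: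
`∫W·:∣φ(y)∣⁴:·:∣φ(z)∣⁴:·:∣φ(z′)∣⁴: = 64N(N+2)(N+8)·C(z,y)²C(z′,y)²C(z′,z)²·Z`.  All four legs of the vertex at `y` are contracted
into the product of the other two (this seat's `B3WickVertexCalculus.integral_wick4_mul`, Leibniz over BRICK 1's contraction chain
`derivAlong_wick4_1 … _4`, `_1k`, `_1kk` at `z` and at `z′`): of the sixteen terms, a constant against `:∣φ∣⁴:` and a leg against a
Wick-ordered cubic integrate to zero (`integral_wick4`, `integral_lin_w3`), and the three "two legs into each" terms are the
two-line kernel `integral_P2_P2` between the Wick-ordered quadratic remainders at `z` and `z′`; per index pair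
`64(N+8)u²u′²v²(1 + 2δ_{ik})`, summed `Σ_{i,k}(1 + 2δ_{ik}) = N(N+2)`.  (At `N = 1`: `1728 = (4!)³/2³` pairings.)  The third-order
vacuum graph of the Wick-ordered `λ∣φ∣⁴` interaction in (1.24). [cite: Balaban1983Higgs3, (1.24) p.417]
[cite: GlimmJaffeQP1987, Prop. 8.3.1, Cor. 8.3.2] -/
theorem integral_wick4_wick4_wick4 (hw : 0 < w) (hm : 0 < m2) (y z z' : Site P j) :
    ∫ φ, weight C η w c m2 (0 : VecField P j ℝ) φ * (wick4 w c m2 y φ * (wick4 w c m2 z φ * wick4 w c m2 z' φ))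
      = 64 * (N * (N + 2) * (N + 8)) * (G w c m2 z y ^ 2 * G w c m2 z' y ^ 2 * G w c m2 z' z ^ 2) * ∫ φ, weight C η w c m2 (0 : VecField P j ℝ) φ := by
  -- growth facts for the pieces of the two contraction chains (at `z` with `u = C(z,y)`, at `z′` with `u′ = C(z′,y)`)
  have hA := expGrowth_wick4 (P := P) (j := j) (N := N) w c m2 z
  have hA' := expGrowth_wick4 (P := P) (j := j) (N := N) w c m2 z'
  have hA1g : ∀ (x : Site P j) (i : Fin N), ExpGrowth (fun φ : Cfg P j N =>
      4 * G w c m2 x y * (⟪φ x, (EuclideanSpace.basisFun (Fin N) ℝ) i⟫_ℝ * (‖φ x‖ ^ 2 - (N + 2) * G w c m2 x x))) :=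
    fun x i => ((ExpGrowth.inner_apply x _).mul ((ExpGrowth.norm_sq_apply x).sub (ExpGrowth.const _))).const_mul _
  have hA2g : ∀ (x : Site P j) (i : Fin N), ExpGrowth (fun φ : Cfg P j N => 4 * G w c m2 x y ^ 2 *
      ((‖φ x‖ ^ 2 - (N + 2) * G w c m2 x x) + 2 * (⟪φ x, (EuclideanSpace.basisFun (Fin N) ℝ) i⟫_ℝ * ⟪φ x, (EuclideanSpace.basisFun (Fin N) ℝ) i⟫_ℝ))) :=
    fun x i => (((ExpGrowth.norm_sq_apply x).sub (ExpGrowth.const _)).add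
      (((ExpGrowth.inner_apply x _).mul (ExpGrowth.inner_apply x _)).const_mul 2)).const_mul _
  have hBg : ∀ (x : Site P j) (i k : Fin N), ExpGrowth (fun φ : Cfg P j N => 4 * G w c m2 x y ^ 2 *
      (⟪(EuclideanSpace.basisFun (Fin N) ℝ) k, (EuclideanSpace.basisFun (Fin N) ℝ) i⟫_ℝ * (‖φ x‖ ^ 2 - (N + 2) * G w c m2 x x) + 2 * (⟪φ x, (EuclideanSpace.basisFun (Fin N) ℝ) i⟫_ℝ * ⟪φ x, (EuclideanSpace.basisFun (Fin N) ℝ) k⟫_ℝ))) :=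
    fun x i k => ((((ExpGrowth.norm_sq_apply x).sub (ExpGrowth.const _)).const_mul _).add
      (((ExpGrowth.inner_apply x _).mul (ExpGrowth.inner_apply x _)).const_mul 2)).const_mul _
  have hBpg : ∀ (x : Site P j) (i k : Fin N), ExpGrowth (fun φ : Cfg P j N => 8 * G w c m2 x y ^ 3 *
      (2 * ⟪(EuclideanSpace.basisFun (Fin N) ℝ) k, (EuclideanSpace.basisFun (Fin N) ℝ) i⟫_ℝ * ⟪φ x, (EuclideanSpace.basisFun (Fin N) ℝ) k⟫_ℝ + ⟪φ x, (EuclideanSpace.basisFun (Fin N) ℝ) i⟫_ℝ)) :=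
    fun x i k => (((ExpGrowth.inner_apply x _).const_mul _).add (ExpGrowth.inner_apply x _)).const_mul _
  have hA3g : ∀ (x : Site P j) (i k : Fin N), ExpGrowth (fun φ : Cfg P j N => 8 * G w c m2 x y ^ 3 *
      (⟪φ x, (EuclideanSpace.basisFun (Fin N) ℝ) k⟫_ℝ + 2 * ⟪(EuclideanSpace.basisFun (Fin N) ℝ) k, (EuclideanSpace.basisFun (Fin N) ℝ) i⟫_ℝ * ⟪φ x, (EuclideanSpace.basisFun (Fin N) ℝ) i⟫_ℝ)) :=
    fun x i k => ((ExpGrowth.inner_apply x _).add ((ExpGrowth.inner_apply x _).const_mul _)).const_mul _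
  -- names for the pieces (as functions): unprimed at `z`, primed at `z′`
  set A : Cfg P j N → ℝ := fun φ => wick4 w c m2 z φ with hAdef
  set A1 : Fin N → Cfg P j N → ℝ := fun i φ =>
    4 * G w c m2 z y * (⟪φ z, (EuclideanSpace.basisFun (Fin N) ℝ) i⟫_ℝ * (‖φ z‖ ^ 2 - (N + 2) * G w c m2 z z)) with hA1def
  set A2 : Fin N → Cfg P j N → ℝ := fun i φ =>
    4 * G w c m2 z y ^ 2 * ((‖φ z‖ ^ 2 - (N + 2) * G w c m2 z z) + 2 * (⟪φ z, (EuclideanSpace.basisFun (Fin N) ℝ) i⟫_ℝ * ⟪φ z, (EuclideanSpace.basisFun (Fin N) ℝ) i⟫_ℝ)) with hA2def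
  set B : Fin N → Fin N → Cfg P j N → ℝ := fun i k φ =>
    4 * G w c m2 z y ^ 2 * (⟪(EuclideanSpace.basisFun (Fin N) ℝ) k, (EuclideanSpace.basisFun (Fin N) ℝ) i⟫_ℝ * (‖φ z‖ ^ 2 - (N + 2) * G w c m2 z z) + 2 * (⟪φ z, (EuclideanSpace.basisFun (Fin N) ℝ) i⟫_ℝ * ⟪φ z, (EuclideanSpace.basisFun (Fin N) ℝ) k⟫_ℝ))
    with hBdef
  set Bp : Fin N → Fin N → Cfg P j N → ℝ := fun i k φ =>
    8 * G w c m2 z y ^ 3 * (2 * ⟪(EuclideanSpace.basisFun (Fin N) ℝ) k, (EuclideanSpace.basisFun (Fin N) ℝ) i⟫_ℝ * ⟪φ z, (EuclideanSpace.basisFun (Fin N) ℝ) k⟫_ℝ + ⟪φ z, (EuclideanSpace.basisFun (Fin N) ℝ) i⟫_ℝ) with hBpdef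
  set A3 : Fin N → Fin N → Cfg P j N → ℝ := fun i k φ =>
    8 * G w c m2 z y ^ 3 * (⟪φ z, (EuclideanSpace.basisFun (Fin N) ℝ) k⟫_ℝ + 2 * ⟪(EuclideanSpace.basisFun (Fin N) ℝ) k, (EuclideanSpace.basisFun (Fin N) ℝ) i⟫_ℝ * ⟪φ z, (EuclideanSpace.basisFun (Fin N) ℝ) i⟫_ℝ) with hA3def
  set A4 : Fin N → Fin N → ℝ := fun i k => 8 * G w c m2 z y ^ 4 * (1 + 2 * ⟪(EuclideanSpace.basisFun (Fin N) ℝ) k, (EuclideanSpace.basisFun (Fin N) ℝ) i⟫_ℝ ^ 2) with hA4def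
  set A' : Cfg P j N → ℝ := fun φ => wick4 w c m2 z' φ with hA'def
  set A1' : Fin N → Cfg P j N → ℝ := fun i φ =>
    4 * G w c m2 z' y * (⟪φ z', (EuclideanSpace.basisFun (Fin N) ℝ) i⟫_ℝ * (‖φ z'‖ ^ 2 - (N + 2) * G w c m2 z' z')) with hA1'def
  set A2' : Fin N → Cfg P j N → ℝ := fun i φ =>
    4 * G w c m2 z' y ^ 2 * ((‖φ z'‖ ^ 2 - (N + 2) * G w c m2 z' z') + 2 * (⟪φ z', (EuclideanSpace.basisFun (Fin N) ℝ) i⟫_ℝ * ⟪φ z', (EuclideanSpace.basisFun (Fin N) ℝ) i⟫_ℝ))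
    with hA2'def
  set B' : Fin N → Fin N → Cfg P j N → ℝ := fun i k φ =>
    4 * G w c m2 z' y ^ 2 * (⟪(EuclideanSpace.basisFun (Fin N) ℝ) k, (EuclideanSpace.basisFun (Fin N) ℝ) i⟫_ℝ * (‖φ z'‖ ^ 2 - (N + 2) * G w c m2 z' z') + 2 * (⟪φ z', (EuclideanSpace.basisFun (Fin N) ℝ) i⟫_ℝ * ⟪φ z', (EuclideanSpace.basisFun (Fin N) ℝ) k⟫_ℝ))
    with hB'def
  set Bp' : Fin N → Fin N → Cfg P j N → ℝ := fun i k φ =>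
    8 * G w c m2 z' y ^ 3 * (2 * ⟪(EuclideanSpace.basisFun (Fin N) ℝ) k, (EuclideanSpace.basisFun (Fin N) ℝ) i⟫_ℝ * ⟪φ z', (EuclideanSpace.basisFun (Fin N) ℝ) k⟫_ℝ + ⟪φ z', (EuclideanSpace.basisFun (Fin N) ℝ) i⟫_ℝ) with hBp'def
  set A3' : Fin N → Fin N → Cfg P j N → ℝ := fun i k φ =>
    8 * G w c m2 z' y ^ 3 * (⟪φ z', (EuclideanSpace.basisFun (Fin N) ℝ) k⟫_ℝ + 2 * ⟪(EuclideanSpace.basisFun (Fin N) ℝ) k, (EuclideanSpace.basisFun (Fin N) ℝ) i⟫_ℝ * ⟪φ z', (EuclideanSpace.basisFun (Fin N) ℝ) i⟫_ℝ) with hA3'def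
  set A4' : Fin N → Fin N → ℝ := fun i k => 8 * G w c m2 z' y ^ 4 * (1 + 2 * ⟪(EuclideanSpace.basisFun (Fin N) ℝ) k, (EuclideanSpace.basisFun (Fin N) ℝ) i⟫_ℝ ^ 2) with hA4'def
  -- the contraction chains (BRICK 1)
  have dA : ∀ i, DerivAlong (hx w c m2 y i) A (A1 i) := fun i => derivAlong_wick4_1 w c m2 y z i
  have dA1 : ∀ i, DerivAlong (hx w c m2 y i) (A1 i) (A2 i) := fun i => derivAlong_wick4_2 w c m2 y z i
  have dA1k : ∀ i k, DerivAlong (hx w c m2 y k) (A1 i) (B i k) := fun i k => derivAlong_wick4_1k w c m2 y z i k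
  have dB : ∀ i k, DerivAlong (hx w c m2 y k) (B i k) (Bp i k) := fun i k => derivAlong_wick4_1kk w c m2 y z i k
  have dA2 : ∀ i k, DerivAlong (hx w c m2 y k) (A2 i) (A3 i k) := fun i k => derivAlong_wick4_3 w c m2 y z i k
  have dA3 : ∀ i k, DerivAlong (hx w c m2 y k) (A3 i k) (fun _ => A4 i k) := fun i k => derivAlong_wick4_4 w c m2 y z i k
  have dA' : ∀ i, DerivAlong (hx w c m2 y i) A' (A1' i) := fun i => derivAlong_wick4_1 w c m2 y z' i
  have dA1' : ∀ i, DerivAlong (hx w c m2 y i) (A1' i) (A2' i) := fun i => derivAlong_wick4_2 w c m2 y z' i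
  have dA1k' : ∀ i k, DerivAlong (hx w c m2 y k) (A1' i) (B' i k) := fun i k => derivAlong_wick4_1k w c m2 y z' i k
  have dB' : ∀ i k, DerivAlong (hx w c m2 y k) (B' i k) (Bp' i k) := fun i k => derivAlong_wick4_1kk w c m2 y z' i k
  have dA2' : ∀ i k, DerivAlong (hx w c m2 y k) (A2' i) (A3' i k) := fun i k => derivAlong_wick4_3 w c m2 y z' i k
  have dA3' : ∀ i k, DerivAlong (hx w c m2 y k) (A3' i k) (fun _ => A4' i k) :=
    fun i k => derivAlong_wick4_4 w c m2 y z' i k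
  -- growth facts in these names
  have gA1 : ∀ i, ExpGrowth (A1 i) := fun i => hA1g z i
  have gA2 : ∀ i, ExpGrowth (A2 i) := fun i => hA2g z i
  have gB : ∀ i k, ExpGrowth (B i k) := fun i k => hBg z i k
  have gBp : ∀ i k, ExpGrowth (Bp i k) := fun i k => hBpg z i k
  have gA3 : ∀ i k, ExpGrowth (A3 i k) := fun i k => hA3g z i k
  have gA1' : ∀ i, ExpGrowth (A1' i) := fun i => hA1g z' i
  have gA2' : ∀ i, ExpGrowth (A2' i) := fun i => hA2g z' i
  have gB' : ∀ i k, ExpGrowth (B' i k) := fun i k => hBg z' i k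
  have gBp' : ∀ i k, ExpGrowth (Bp' i k) := fun i k => hBpg z' i k
  have gA3' : ∀ i k, ExpGrowth (A3' i k) := fun i k => hA3g z' i k
  -- the raw Leibniz chain of `R = A·A′`
  have key := integral_wick4_mul C η w c m2 hw hm y (R := fun φ : Cfg P j N => A φ * A' φ)
    (R₁ := fun i φ => A1 i φ * A' φ + A φ * A1' i φ)
    (R₂ := fun i φ => (A2 i φ * A' φ + A1 i φ * A1' i φ) + (A1 i φ * A1' i φ + A φ * A2' i φ))
    (R₃ := fun i k φ => ((A3 i k φ * A' φ + A2 i φ * A1' k φ) + (B i k φ * A1' i φ + A1 i φ * B' i k φ))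
      + ((B i k φ * A1' i φ + A1 i φ * B' i k φ) + (A1 k φ * A2' i φ + A φ * A3' i k φ)))
    (R₄ := fun i k φ => (((A4 i k * A' φ + A3 i k φ * A1' k φ) + (A3 i k φ * A1' k φ + A2 i φ * A2' k φ))
        + ((Bp i k φ * A1' i φ + B i k φ * B' i k φ) + (B i k φ * B' i k φ + A1 i φ * Bp' i k φ)))
      + (((Bp i k φ * A1' i φ + B i k φ * B' i k φ) + (B i k φ * B' i k φ + A1 i φ * Bp' i k φ))
        + ((A2 k φ * A2' i φ + A1 k φ * A3' i k φ) + (A1 k φ * A3' i k φ + A φ * A4' i k))))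
    (hA.mul hA')
    (fun i => ((gA1 i).mul hA').add (hA.mul (gA1' i)))
    (fun i => (((gA2 i).mul hA').add ((gA1 i).mul (gA1' i))).add (((gA1 i).mul (gA1' i)).add (hA.mul (gA2' i))))
    (fun i k => ((((gA3 i k).mul hA').add ((gA2 i).mul (gA1' k))).add (((gB i k).mul (gA1' i)).add
      ((gA1 i).mul (gB' i k)))).add ((((gB i k).mul (gA1' i)).add ((gA1 i).mul (gB' i k))).add
      (((gA1 k).mul (gA2' i)).add (hA.mul (gA3' i k)))))
    (fun i k => (((((ExpGrowth.const _).mul hA').add ((gA3 i k).mul (gA1' k))).add (((gA3 i k).mul (gA1' k)).add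
      ((gA2 i).mul (gA2' k)))).add ((((gBp i k).mul (gA1' i)).add ((gB i k).mul (gB' i k))).add
      (((gB i k).mul (gB' i k)).add ((gA1 i).mul (gBp' i k))))).add
      (((((gBp i k).mul (gA1' i)).add ((gB i k).mul (gB' i k))).add
      (((gB i k).mul (gB' i k)).add ((gA1 i).mul (gBp' i k)))).add
      ((((gA2 k).mul (gA2' i)).add ((gA1 k).mul (gA3' i k))).add
      (((gA1 k).mul (gA3' i k)).add (hA.mul (ExpGrowth.const _))))))
    (fun i => (dA i).mul (dA' i))
    (fun i => ((dA1 i).mul (dA' i)).add ((dA i).mul (dA1' i)))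
    (fun i k => (((dA2 i k).mul (dA' k)).add ((dA1k i k).mul (dA1k' i k))).add
      (((dA1k i k).mul (dA1k' i k)).add ((dA k).mul (dA2' i k))))
    (fun i k => ((((dA3 i k).mul (dA' k)).add ((dA2 i k).mul (dA1' k))).add
      (((dB i k).mul (dA1k' i k)).add ((dA1k i k).mul (dB' i k)))).add
      ((((dB i k).mul (dA1k' i k)).add ((dA1k i k).mul (dB' i k))).add
      (((dA1 k).mul (dA2' i k)).add ((dA k).mul (dA3' i k)))))
  -- the vanishing terms
  have v1 : ∀ i k, ∫ φ, weight C η w c m2 (0 : VecField P j ℝ) φ * (A4 i k * A' φ) = 0 := by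
    intro i k
    rw [integral_W_const_mul, hA'def, integral_wick4 C η w c m2 hw hm z', mul_zero]
  have v6 : ∀ i k, ∫ φ, weight C η w c m2 (0 : VecField P j ℝ) φ * (A φ * A4' i k) = 0 := by
    intro i k
    have e : (fun φ : Cfg P j N => weight C η w c m2 (0 : VecField P j ℝ) φ * (A φ * A4' i k)) = fun φ => weight C η w c m2 (0 : VecField P j ℝ) φ * (A4' i k * A φ) := by
      funext φ; ring
    rw [e, integral_W_const_mul, hAdef, integral_wick4 C η w c m2 hw hm z, mul_zero]
  have v2 : ∀ i k, ∫ φ, weight C η w c m2 (0 : VecField P j ℝ) φ * (A3 i k φ * A1' k φ) = 0 := by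
    intro i k
    have e : (fun φ : Cfg P j N => weight C η w c m2 (0 : VecField P j ℝ) φ * (A3 i k φ * A1' k φ)) = fun φ => weight C η w c m2 (0 : VecField P j ℝ) φ *
        ((8 * G w c m2 z y ^ 3 * (4 * G w c m2 z' y)) *
          (⟪φ z, (EuclideanSpace.basisFun (Fin N) ℝ) k⟫_ℝ * (⟪φ z', (EuclideanSpace.basisFun (Fin N) ℝ) k⟫_ℝ * (‖φ z'‖ ^ 2 - (N + 2) * G w c m2 z' z')))
        + (8 * G w c m2 z y ^ 3 * (4 * G w c m2 z' y) * (2 * ⟪(EuclideanSpace.basisFun (Fin N) ℝ) k, (EuclideanSpace.basisFun (Fin N) ℝ) i⟫_ℝ)) *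
          (⟪φ z, (EuclideanSpace.basisFun (Fin N) ℝ) i⟫_ℝ * (⟪φ z', (EuclideanSpace.basisFun (Fin N) ℝ) k⟫_ℝ * (‖φ z'‖ ^ 2 - (N + 2) * G w c m2 z' z')))) := by
      funext φ; simp only [hA3def, hA1'def]; ring
    rw [e, integral_W_add C η w c m2 hw hm
      (((ExpGrowth.inner_apply z _).mul ((ExpGrowth.inner_apply z' _).mul
        ((ExpGrowth.norm_sq_apply z').sub (ExpGrowth.const _)))).const_mul _)
      (((ExpGrowth.inner_apply z _).mul ((ExpGrowth.inner_apply z' _).mul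
        ((ExpGrowth.norm_sq_apply z').sub (ExpGrowth.const _)))).const_mul _),
      integral_W_const_mul, integral_W_const_mul, integral_lin_w3 C η w c m2 hw hm, integral_lin_w3 C η w c m2 hw hm]
    ring
  have v3 : ∀ i k, ∫ φ, weight C η w c m2 (0 : VecField P j ℝ) φ * (Bp i k φ * A1' i φ) = 0 := by
    intro i k
    have e : (fun φ : Cfg P j N => weight C η w c m2 (0 : VecField P j ℝ) φ * (Bp i k φ * A1' i φ)) = fun φ => weight C η w c m2 (0 : VecField P j ℝ) φ *
        ((8 * G w c m2 z y ^ 3 * (4 * G w c m2 z' y) * (2 * ⟪(EuclideanSpace.basisFun (Fin N) ℝ) k, (EuclideanSpace.basisFun (Fin N) ℝ) i⟫_ℝ)) *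
          (⟪φ z, (EuclideanSpace.basisFun (Fin N) ℝ) k⟫_ℝ * (⟪φ z', (EuclideanSpace.basisFun (Fin N) ℝ) i⟫_ℝ * (‖φ z'‖ ^ 2 - (N + 2) * G w c m2 z' z')))
        + (8 * G w c m2 z y ^ 3 * (4 * G w c m2 z' y)) *
          (⟪φ z, (EuclideanSpace.basisFun (Fin N) ℝ) i⟫_ℝ * (⟪φ z', (EuclideanSpace.basisFun (Fin N) ℝ) i⟫_ℝ * (‖φ z'‖ ^ 2 - (N + 2) * G w c m2 z' z')))) := by
      funext φ; simp only [hBpdef, hA1'def]; ring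
    rw [e, integral_W_add C η w c m2 hw hm
      (((ExpGrowth.inner_apply z _).mul ((ExpGrowth.inner_apply z' _).mul
        ((ExpGrowth.norm_sq_apply z').sub (ExpGrowth.const _)))).const_mul _)
      (((ExpGrowth.inner_apply z _).mul ((ExpGrowth.inner_apply z' _).mul
        ((ExpGrowth.norm_sq_apply z').sub (ExpGrowth.const _)))).const_mul _),
      integral_W_const_mul, integral_W_const_mul, integral_lin_w3 C η w c m2 hw hm, integral_lin_w3 C η w c m2 hw hm]
    ring
  have v4 : ∀ i k, ∫ φ, weight C η w c m2 (0 : VecField P j ℝ) φ * (A1 i φ * Bp' i k φ) = 0 := by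
    intro i k
    have e : (fun φ : Cfg P j N => weight C η w c m2 (0 : VecField P j ℝ) φ * (A1 i φ * Bp' i k φ)) = fun φ => weight C η w c m2 (0 : VecField P j ℝ) φ *
        ((4 * G w c m2 z y * (8 * G w c m2 z' y ^ 3) * (2 * ⟪(EuclideanSpace.basisFun (Fin N) ℝ) k, (EuclideanSpace.basisFun (Fin N) ℝ) i⟫_ℝ)) *
          ((⟪φ z, (EuclideanSpace.basisFun (Fin N) ℝ) i⟫_ℝ * (‖φ z‖ ^ 2 - (N + 2) * G w c m2 z z)) * ⟪φ z', (EuclideanSpace.basisFun (Fin N) ℝ) k⟫_ℝ)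
        + (4 * G w c m2 z y * (8 * G w c m2 z' y ^ 3)) *
          ((⟪φ z, (EuclideanSpace.basisFun (Fin N) ℝ) i⟫_ℝ * (‖φ z‖ ^ 2 - (N + 2) * G w c m2 z z)) * ⟪φ z', (EuclideanSpace.basisFun (Fin N) ℝ) i⟫_ℝ)) := by
      funext φ; simp only [hA1def, hBp'def]; ring
    rw [e, integral_W_add C η w c m2 hw hm
      ((((ExpGrowth.inner_apply z _).mul ((ExpGrowth.norm_sq_apply z).sub (ExpGrowth.const _))).mul
        (ExpGrowth.inner_apply z' _)).const_mul _)
      ((((ExpGrowth.inner_apply z _).mul ((ExpGrowth.norm_sq_apply z).sub (ExpGrowth.const _))).mul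
        (ExpGrowth.inner_apply z' _)).const_mul _),
      integral_W_const_mul, integral_W_const_mul, integral_w3_lin C η w c m2 hw hm, integral_w3_lin C η w c m2 hw hm]
    ring
  have v5 : ∀ i k, ∫ φ, weight C η w c m2 (0 : VecField P j ℝ) φ * (A1 k φ * A3' i k φ) = 0 := by
    intro i k
    have e : (fun φ : Cfg P j N => weight C η w c m2 (0 : VecField P j ℝ) φ * (A1 k φ * A3' i k φ)) = fun φ => weight C η w c m2 (0 : VecField P j ℝ) φ *
        ((4 * G w c m2 z y * (8 * G w c m2 z' y ^ 3)) *
          ((⟪φ z, (EuclideanSpace.basisFun (Fin N) ℝ) k⟫_ℝ * (‖φ z‖ ^ 2 - (N + 2) * G w c m2 z z)) * ⟪φ z', (EuclideanSpace.basisFun (Fin N) ℝ) k⟫_ℝ)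
        + (4 * G w c m2 z y * (8 * G w c m2 z' y ^ 3) * (2 * ⟪(EuclideanSpace.basisFun (Fin N) ℝ) k, (EuclideanSpace.basisFun (Fin N) ℝ) i⟫_ℝ)) *
          ((⟪φ z, (EuclideanSpace.basisFun (Fin N) ℝ) k⟫_ℝ * (‖φ z‖ ^ 2 - (N + 2) * G w c m2 z z)) * ⟪φ z', (EuclideanSpace.basisFun (Fin N) ℝ) i⟫_ℝ)) := by
      funext φ; simp only [hA1def, hA3'def]; ring
    rw [e, integral_W_add C η w c m2 hw hm
      ((((ExpGrowth.inner_apply z _).mul ((ExpGrowth.norm_sq_apply z).sub (ExpGrowth.const _))).mul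
        (ExpGrowth.inner_apply z' _)).const_mul _)
      ((((ExpGrowth.inner_apply z _).mul ((ExpGrowth.norm_sq_apply z).sub (ExpGrowth.const _))).mul
        (ExpGrowth.inner_apply z' _)).const_mul _),
      integral_W_const_mul, integral_W_const_mul, integral_w3_lin C η w c m2 hw hm, integral_w3_lin C η w c m2 hw hm]
    ring
  -- the three main terms: two legs of `y` into each of the other vertices (`integral_P2_P2`)
  have m1 : ∀ i k, ∫ φ, weight C η w c m2 (0 : VecField P j ℝ) φ * (A2 i φ * A2' k φ) = 4 * G w c m2 z y ^ 2 * (4 * G w c m2 z' y ^ 2) *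
      (2 * G w c m2 z' z ^ 2 * (∫ φ, weight C η w c m2 (0 : VecField P j ℝ) φ) * ((N + 4) * (⟪(EuclideanSpace.basisFun (Fin N) ℝ) i, (EuclideanSpace.basisFun (Fin N) ℝ) i⟫_ℝ * ⟪(EuclideanSpace.basisFun (Fin N) ℝ) k, (EuclideanSpace.basisFun (Fin N) ℝ) k⟫_ℝ)
        + 2 * (⟪(EuclideanSpace.basisFun (Fin N) ℝ) i, (EuclideanSpace.basisFun (Fin N) ℝ) k⟫_ℝ * ⟪(EuclideanSpace.basisFun (Fin N) ℝ) i, (EuclideanSpace.basisFun (Fin N) ℝ) k⟫_ℝ + ⟪(EuclideanSpace.basisFun (Fin N) ℝ) i, (EuclideanSpace.basisFun (Fin N) ℝ) k⟫_ℝ * ⟪(EuclideanSpace.basisFun (Fin N) ℝ) i, (EuclideanSpace.basisFun (Fin N) ℝ) k⟫_ℝ))) := by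
    intro i k
    have e : (fun φ : Cfg P j N => weight C η w c m2 (0 : VecField P j ℝ) φ * (A2 i φ * A2' k φ)) = fun φ => weight C η w c m2 (0 : VecField P j ℝ) φ *
        ((4 * G w c m2 z y ^ 2 * (4 * G w c m2 z' y ^ 2)) *
          ((⟪(EuclideanSpace.basisFun (Fin N) ℝ) i, (EuclideanSpace.basisFun (Fin N) ℝ) i⟫_ℝ * (‖φ z‖ ^ 2 - (N + 2) * G w c m2 z z) + 2 * (⟪φ z, (EuclideanSpace.basisFun (Fin N) ℝ) i⟫_ℝ * ⟪φ z, (EuclideanSpace.basisFun (Fin N) ℝ) i⟫_ℝ))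
            * (⟪(EuclideanSpace.basisFun (Fin N) ℝ) k, (EuclideanSpace.basisFun (Fin N) ℝ) k⟫_ℝ * (‖φ z'‖ ^ 2 - (N + 2) * G w c m2 z' z') + 2 * (⟪φ z', (EuclideanSpace.basisFun (Fin N) ℝ) k⟫_ℝ * ⟪φ z', (EuclideanSpace.basisFun (Fin N) ℝ) k⟫_ℝ)))) := by
      funext φ; simp only [hA2def, hA2'def]; rw [inner_basis_self, inner_basis_self]; ring
    rw [e, integral_W_const_mul, integral_P2_P2 C η w c m2 hw hm z z' i i k k]
  have m2' : ∀ i k, ∫ φ, weight C η w c m2 (0 : VecField P j ℝ) φ * (B i k φ * B' i k φ) = 4 * G w c m2 z y ^ 2 * (4 * G w c m2 z' y ^ 2) *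
      (2 * G w c m2 z' z ^ 2 * (∫ φ, weight C η w c m2 (0 : VecField P j ℝ) φ) * ((N + 4) * (⟪(EuclideanSpace.basisFun (Fin N) ℝ) k, (EuclideanSpace.basisFun (Fin N) ℝ) i⟫_ℝ * ⟪(EuclideanSpace.basisFun (Fin N) ℝ) k, (EuclideanSpace.basisFun (Fin N) ℝ) i⟫_ℝ)
        + 2 * (⟪(EuclideanSpace.basisFun (Fin N) ℝ) i, (EuclideanSpace.basisFun (Fin N) ℝ) i⟫_ℝ * ⟪(EuclideanSpace.basisFun (Fin N) ℝ) k, (EuclideanSpace.basisFun (Fin N) ℝ) k⟫_ℝ + ⟪(EuclideanSpace.basisFun (Fin N) ℝ) k, (EuclideanSpace.basisFun (Fin N) ℝ) i⟫_ℝ * ⟪(EuclideanSpace.basisFun (Fin N) ℝ) i, (EuclideanSpace.basisFun (Fin N) ℝ) k⟫_ℝ))) := by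
    intro i k
    have e : (fun φ : Cfg P j N => weight C η w c m2 (0 : VecField P j ℝ) φ * (B i k φ * B' i k φ)) = fun φ => weight C η w c m2 (0 : VecField P j ℝ) φ *
        ((4 * G w c m2 z y ^ 2 * (4 * G w c m2 z' y ^ 2)) *
          ((⟪(EuclideanSpace.basisFun (Fin N) ℝ) k, (EuclideanSpace.basisFun (Fin N) ℝ) i⟫_ℝ * (‖φ z‖ ^ 2 - (N + 2) * G w c m2 z z) + 2 * (⟪φ z, (EuclideanSpace.basisFun (Fin N) ℝ) i⟫_ℝ * ⟪φ z, (EuclideanSpace.basisFun (Fin N) ℝ) k⟫_ℝ))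
            * (⟪(EuclideanSpace.basisFun (Fin N) ℝ) k, (EuclideanSpace.basisFun (Fin N) ℝ) i⟫_ℝ * (‖φ z'‖ ^ 2 - (N + 2) * G w c m2 z' z') + 2 * (⟪φ z', (EuclideanSpace.basisFun (Fin N) ℝ) i⟫_ℝ * ⟪φ z', (EuclideanSpace.basisFun (Fin N) ℝ) k⟫_ℝ)))) := by
      funext φ; simp only [hBdef, hB'def]; ring
    rw [e, integral_W_const_mul, integral_P2_P2 C η w c m2 hw hm z z' i k i k]
  have m3 : ∀ i k, ∫ φ, weight C η w c m2 (0 : VecField P j ℝ) φ * (A2 k φ * A2' i φ) = 4 * G w c m2 z y ^ 2 * (4 * G w c m2 z' y ^ 2) *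
      (2 * G w c m2 z' z ^ 2 * (∫ φ, weight C η w c m2 (0 : VecField P j ℝ) φ) * ((N + 4) * (⟪(EuclideanSpace.basisFun (Fin N) ℝ) k, (EuclideanSpace.basisFun (Fin N) ℝ) k⟫_ℝ * ⟪(EuclideanSpace.basisFun (Fin N) ℝ) i, (EuclideanSpace.basisFun (Fin N) ℝ) i⟫_ℝ)
        + 2 * (⟪(EuclideanSpace.basisFun (Fin N) ℝ) k, (EuclideanSpace.basisFun (Fin N) ℝ) i⟫_ℝ * ⟪(EuclideanSpace.basisFun (Fin N) ℝ) k, (EuclideanSpace.basisFun (Fin N) ℝ) i⟫_ℝ + ⟪(EuclideanSpace.basisFun (Fin N) ℝ) k, (EuclideanSpace.basisFun (Fin N) ℝ) i⟫_ℝ * ⟪(EuclideanSpace.basisFun (Fin N) ℝ) k, (EuclideanSpace.basisFun (Fin N) ℝ) i⟫_ℝ))) := by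
    intro i k
    have e : (fun φ : Cfg P j N => weight C η w c m2 (0 : VecField P j ℝ) φ * (A2 k φ * A2' i φ)) = fun φ => weight C η w c m2 (0 : VecField P j ℝ) φ *
        ((4 * G w c m2 z y ^ 2 * (4 * G w c m2 z' y ^ 2)) *
          ((⟪(EuclideanSpace.basisFun (Fin N) ℝ) k, (EuclideanSpace.basisFun (Fin N) ℝ) k⟫_ℝ * (‖φ z‖ ^ 2 - (N + 2) * G w c m2 z z) + 2 * (⟪φ z, (EuclideanSpace.basisFun (Fin N) ℝ) k⟫_ℝ * ⟪φ z, (EuclideanSpace.basisFun (Fin N) ℝ) k⟫_ℝ))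
            * (⟪(EuclideanSpace.basisFun (Fin N) ℝ) i, (EuclideanSpace.basisFun (Fin N) ℝ) i⟫_ℝ * (‖φ z'‖ ^ 2 - (N + 2) * G w c m2 z' z') + 2 * (⟪φ z', (EuclideanSpace.basisFun (Fin N) ℝ) i⟫_ℝ * ⟪φ z', (EuclideanSpace.basisFun (Fin N) ℝ) i⟫_ℝ)))) := by
      funext φ; simp only [hA2def, hA2'def]; rw [inner_basis_self, inner_basis_self]; ring
    rw [e, integral_W_const_mul, integral_P2_P2 C η w c m2 hw hm z z' k k i i]
  -- integrate the fourth contraction termwise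
  have hterm : ∀ i k, ∫ φ, weight C η w c m2 (0 : VecField P j ℝ) φ * ((((A4 i k * A' φ + A3 i k φ * A1' k φ) + (A3 i k φ * A1' k φ + A2 i φ * A2' k φ))
        + ((Bp i k φ * A1' i φ + B i k φ * B' i k φ) + (B i k φ * B' i k φ + A1 i φ * Bp' i k φ)))
      + (((Bp i k φ * A1' i φ + B i k φ * B' i k φ) + (B i k φ * B' i k φ + A1 i φ * Bp' i k φ))
        + ((A2 k φ * A2' i φ + A1 k φ * A3' i k φ) + (A1 k φ * A3' i k φ + A φ * A4' i k))))
      = 4 * G w c m2 z y ^ 2 * (4 * G w c m2 z' y ^ 2) *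
          (2 * G w c m2 z' z ^ 2 * (∫ φ, weight C η w c m2 (0 : VecField P j ℝ) φ) * ((N + 4) * (⟪(EuclideanSpace.basisFun (Fin N) ℝ) i, (EuclideanSpace.basisFun (Fin N) ℝ) i⟫_ℝ * ⟪(EuclideanSpace.basisFun (Fin N) ℝ) k, (EuclideanSpace.basisFun (Fin N) ℝ) k⟫_ℝ)
            + 2 * (⟪(EuclideanSpace.basisFun (Fin N) ℝ) i, (EuclideanSpace.basisFun (Fin N) ℝ) k⟫_ℝ * ⟪(EuclideanSpace.basisFun (Fin N) ℝ) i, (EuclideanSpace.basisFun (Fin N) ℝ) k⟫_ℝ + ⟪(EuclideanSpace.basisFun (Fin N) ℝ) i, (EuclideanSpace.basisFun (Fin N) ℝ) k⟫_ℝ * ⟪(EuclideanSpace.basisFun (Fin N) ℝ) i, (EuclideanSpace.basisFun (Fin N) ℝ) k⟫_ℝ)))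
        + 4 * (4 * G w c m2 z y ^ 2 * (4 * G w c m2 z' y ^ 2) *
          (2 * G w c m2 z' z ^ 2 * (∫ φ, weight C η w c m2 (0 : VecField P j ℝ) φ) * ((N + 4) * (⟪(EuclideanSpace.basisFun (Fin N) ℝ) k, (EuclideanSpace.basisFun (Fin N) ℝ) i⟫_ℝ * ⟪(EuclideanSpace.basisFun (Fin N) ℝ) k, (EuclideanSpace.basisFun (Fin N) ℝ) i⟫_ℝ)
            + 2 * (⟪(EuclideanSpace.basisFun (Fin N) ℝ) i, (EuclideanSpace.basisFun (Fin N) ℝ) i⟫_ℝ * ⟪(EuclideanSpace.basisFun (Fin N) ℝ) k, (EuclideanSpace.basisFun (Fin N) ℝ) k⟫_ℝ + ⟪(EuclideanSpace.basisFun (Fin N) ℝ) k, (EuclideanSpace.basisFun (Fin N) ℝ) i⟫_ℝ * ⟪(EuclideanSpace.basisFun (Fin N) ℝ) i, (EuclideanSpace.basisFun (Fin N) ℝ) k⟫_ℝ))))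
        + 4 * G w c m2 z y ^ 2 * (4 * G w c m2 z' y ^ 2) *
          (2 * G w c m2 z' z ^ 2 * (∫ φ, weight C η w c m2 (0 : VecField P j ℝ) φ) * ((N + 4) * (⟪(EuclideanSpace.basisFun (Fin N) ℝ) k, (EuclideanSpace.basisFun (Fin N) ℝ) k⟫_ℝ * ⟪(EuclideanSpace.basisFun (Fin N) ℝ) i, (EuclideanSpace.basisFun (Fin N) ℝ) i⟫_ℝ)
            + 2 * (⟪(EuclideanSpace.basisFun (Fin N) ℝ) k, (EuclideanSpace.basisFun (Fin N) ℝ) i⟫_ℝ * ⟪(EuclideanSpace.basisFun (Fin N) ℝ) k, (EuclideanSpace.basisFun (Fin N) ℝ) i⟫_ℝ + ⟪(EuclideanSpace.basisFun (Fin N) ℝ) k, (EuclideanSpace.basisFun (Fin N) ℝ) i⟫_ℝ * ⟪(EuclideanSpace.basisFun (Fin N) ℝ) k, (EuclideanSpace.basisFun (Fin N) ℝ) i⟫_ℝ))) := by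
    intro i k
    -- regroup the sixteen terms into nine (pointwise)
    have e : (fun φ : Cfg P j N => weight C η w c m2 (0 : VecField P j ℝ) φ * ((((A4 i k * A' φ + A3 i k φ * A1' k φ) + (A3 i k φ * A1' k φ + A2 i φ * A2' k φ))
        + ((Bp i k φ * A1' i φ + B i k φ * B' i k φ) + (B i k φ * B' i k φ + A1 i φ * Bp' i k φ)))
      + (((Bp i k φ * A1' i φ + B i k φ * B' i k φ) + (B i k φ * B' i k φ + A1 i φ * Bp' i k φ))
        + ((A2 k φ * A2' i φ + A1 k φ * A3' i k φ) + (A1 k φ * A3' i k φ + A φ * A4' i k)))))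
        = fun φ => weight C η w c m2 (0 : VecField P j ℝ) φ * ((A4 i k * A' φ + (2 * (A3 i k φ * A1' k φ) + (A2 i φ * A2' k φ
          + (2 * (Bp i k φ * A1' i φ) + 4 * (B i k φ * B' i k φ)))))
          + (2 * (A1 i φ * Bp' i k φ) + (A2 k φ * A2' i φ + (2 * (A1 k φ * A3' i k φ) + A φ * A4' i k)))) := by
      funext φ; ring
    have g1 : ExpGrowth (fun φ : Cfg P j N => A4 i k * A' φ) := hA'.const_mul _
    have g2 : ExpGrowth (fun φ : Cfg P j N => 2 * (A3 i k φ * A1' k φ)) := ((gA3 i k).mul (gA1' k)).const_mul _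
    have g3 : ExpGrowth (fun φ : Cfg P j N => A2 i φ * A2' k φ) := (gA2 i).mul (gA2' k)
    have g4 : ExpGrowth (fun φ : Cfg P j N => 2 * (Bp i k φ * A1' i φ)) := ((gBp i k).mul (gA1' i)).const_mul _
    have g5 : ExpGrowth (fun φ : Cfg P j N => 4 * (B i k φ * B' i k φ)) := ((gB i k).mul (gB' i k)).const_mul _
    have g6 : ExpGrowth (fun φ : Cfg P j N => 2 * (A1 i φ * Bp' i k φ)) := ((gA1 i).mul (gBp' i k)).const_mul _
    have g7 : ExpGrowth (fun φ : Cfg P j N => A2 k φ * A2' i φ) := (gA2 k).mul (gA2' i)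
    have g8 : ExpGrowth (fun φ : Cfg P j N => 2 * (A1 k φ * A3' i k φ)) := ((gA1 k).mul (gA3' i k)).const_mul _
    have g9 : ExpGrowth (fun φ : Cfg P j N => A φ * A4' i k) := hA.mul (ExpGrowth.const _)
    rw [e, integral_W_add C η w c m2 hw hm (g1.add (g2.add (g3.add (g4.add g5)))) (g6.add (g7.add (g8.add g9))),
      integral_W_add C η w c m2 hw hm g1 (g2.add (g3.add (g4.add g5))),
      integral_W_add C η w c m2 hw hm g2 (g3.add (g4.add g5)), integral_W_add C η w c m2 hw hm g3 (g4.add g5),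
      integral_W_add C η w c m2 hw hm g4 g5, integral_W_add C η w c m2 hw hm g6 (g7.add (g8.add g9)),
      integral_W_add C η w c m2 hw hm g7 (g8.add g9), integral_W_add C η w c m2 hw hm g8 g9]
    have c2 : ∫ φ, weight C η w c m2 (0 : VecField P j ℝ) φ * (2 * (A3 i k φ * A1' k φ)) = 2 * ∫ φ, weight C η w c m2 (0 : VecField P j ℝ) φ * (A3 i k φ * A1' k φ) :=
      integral_W_const_mul C η w c m2 2 _
    have c4 : ∫ φ, weight C η w c m2 (0 : VecField P j ℝ) φ * (2 * (Bp i k φ * A1' i φ)) = 2 * ∫ φ, weight C η w c m2 (0 : VecField P j ℝ) φ * (Bp i k φ * A1' i φ) :=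
      integral_W_const_mul C η w c m2 2 _
    have c5 : ∫ φ, weight C η w c m2 (0 : VecField P j ℝ) φ * (4 * (B i k φ * B' i k φ)) = 4 * ∫ φ, weight C η w c m2 (0 : VecField P j ℝ) φ * (B i k φ * B' i k φ) :=
      integral_W_const_mul C η w c m2 4 _
    have c6 : ∫ φ, weight C η w c m2 (0 : VecField P j ℝ) φ * (2 * (A1 i φ * Bp' i k φ)) = 2 * ∫ φ, weight C η w c m2 (0 : VecField P j ℝ) φ * (A1 i φ * Bp' i k φ) :=
      integral_W_const_mul C η w c m2 2 _
    have c8 : ∫ φ, weight C η w c m2 (0 : VecField P j ℝ) φ * (2 * (A1 k φ * A3' i k φ)) = 2 * ∫ φ, weight C η w c m2 (0 : VecField P j ℝ) φ * (A1 k φ * A3' i k φ) :=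
      integral_W_const_mul C η w c m2 2 _
    rw [c2, c4, c5, c6, c8, v1, v2, v3, v4, v5, v6, m1, m2', m3]
    ring
  rw [show (∫ φ, weight C η w c m2 (0 : VecField P j ℝ) φ * (wick4 w c m2 y φ * (wick4 w c m2 z φ * wick4 w c m2 z' φ)))
      = ∫ φ, weight C η w c m2 (0 : VecField P j ℝ) φ * (wick4 w c m2 y φ * (A φ * A' φ)) from rfl, key]
  simp_rw [hterm]
  -- the index sums: `⟪e_i,e_i⟫ = 1`, `⟪e_k,e_i⟫⟪e_i,e_k⟫ = ⟪e_k,e_i⟫²`, `Σ_{i,k}⟪e_k,e_i⟫² = N`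
  have hik : ∀ i k : Fin N,
      4 * G w c m2 z y ^ 2 * (4 * G w c m2 z' y ^ 2) *
          (2 * G w c m2 z' z ^ 2 * (∫ φ, weight C η w c m2 (0 : VecField P j ℝ) φ) * ((N + 4) * (⟪(EuclideanSpace.basisFun (Fin N) ℝ) i, (EuclideanSpace.basisFun (Fin N) ℝ) i⟫_ℝ * ⟪(EuclideanSpace.basisFun (Fin N) ℝ) k, (EuclideanSpace.basisFun (Fin N) ℝ) k⟫_ℝ)
            + 2 * (⟪(EuclideanSpace.basisFun (Fin N) ℝ) i, (EuclideanSpace.basisFun (Fin N) ℝ) k⟫_ℝ * ⟪(EuclideanSpace.basisFun (Fin N) ℝ) i, (EuclideanSpace.basisFun (Fin N) ℝ) k⟫_ℝ + ⟪(EuclideanSpace.basisFun (Fin N) ℝ) i, (EuclideanSpace.basisFun (Fin N) ℝ) k⟫_ℝ * ⟪(EuclideanSpace.basisFun (Fin N) ℝ) i, (EuclideanSpace.basisFun (Fin N) ℝ) k⟫_ℝ)))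
        + 4 * (4 * G w c m2 z y ^ 2 * (4 * G w c m2 z' y ^ 2) *
          (2 * G w c m2 z' z ^ 2 * (∫ φ, weight C η w c m2 (0 : VecField P j ℝ) φ) * ((N + 4) * (⟪(EuclideanSpace.basisFun (Fin N) ℝ) k, (EuclideanSpace.basisFun (Fin N) ℝ) i⟫_ℝ * ⟪(EuclideanSpace.basisFun (Fin N) ℝ) k, (EuclideanSpace.basisFun (Fin N) ℝ) i⟫_ℝ)
            + 2 * (⟪(EuclideanSpace.basisFun (Fin N) ℝ) i, (EuclideanSpace.basisFun (Fin N) ℝ) i⟫_ℝ * ⟪(EuclideanSpace.basisFun (Fin N) ℝ) k, (EuclideanSpace.basisFun (Fin N) ℝ) k⟫_ℝ + ⟪(EuclideanSpace.basisFun (Fin N) ℝ) k, (EuclideanSpace.basisFun (Fin N) ℝ) i⟫_ℝ * ⟪(EuclideanSpace.basisFun (Fin N) ℝ) i, (EuclideanSpace.basisFun (Fin N) ℝ) k⟫_ℝ))))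
        + 4 * G w c m2 z y ^ 2 * (4 * G w c m2 z' y ^ 2) *
          (2 * G w c m2 z' z ^ 2 * (∫ φ, weight C η w c m2 (0 : VecField P j ℝ) φ) * ((N + 4) * (⟪(EuclideanSpace.basisFun (Fin N) ℝ) k, (EuclideanSpace.basisFun (Fin N) ℝ) k⟫_ℝ * ⟪(EuclideanSpace.basisFun (Fin N) ℝ) i, (EuclideanSpace.basisFun (Fin N) ℝ) i⟫_ℝ)
            + 2 * (⟪(EuclideanSpace.basisFun (Fin N) ℝ) k, (EuclideanSpace.basisFun (Fin N) ℝ) i⟫_ℝ * ⟪(EuclideanSpace.basisFun (Fin N) ℝ) k, (EuclideanSpace.basisFun (Fin N) ℝ) i⟫_ℝ + ⟪(EuclideanSpace.basisFun (Fin N) ℝ) k, (EuclideanSpace.basisFun (Fin N) ℝ) i⟫_ℝ * ⟪(EuclideanSpace.basisFun (Fin N) ℝ) k, (EuclideanSpace.basisFun (Fin N) ℝ) i⟫_ℝ)))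
      = 64 * (N + 8) * (G w c m2 z y ^ 2 * G w c m2 z' y ^ 2 * G w c m2 z' z ^ 2) * (∫ φ, weight C η w c m2 (0 : VecField P j ℝ) φ)
          * (1 + 2 * ⟪(EuclideanSpace.basisFun (Fin N) ℝ) k, (EuclideanSpace.basisFun (Fin N) ℝ) i⟫_ℝ ^ 2) := by
    intro i k
    rw [inner_basis_self, inner_basis_self, real_inner_comm ((EuclideanSpace.basisFun (Fin N) ℝ) k) ((EuclideanSpace.basisFun (Fin N) ℝ) i)]
    ring
  simp_rw [hik]
  have hS : ∑ i : Fin N, ∑ k : Fin N, (1 + 2 * ⟪(EuclideanSpace.basisFun (Fin N) ℝ) k, (EuclideanSpace.basisFun (Fin N) ℝ) i⟫_ℝ ^ 2) = (N : ℝ) * N + 2 * N := by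
    have h1 : ∀ i : Fin N, ∑ k : Fin N, (1 + 2 * ⟪(EuclideanSpace.basisFun (Fin N) ℝ) k, (EuclideanSpace.basisFun (Fin N) ℝ) i⟫_ℝ ^ 2) = N + 2 * ∑ k : Fin N, ⟪(EuclideanSpace.basisFun (Fin N) ℝ) k, (EuclideanSpace.basisFun (Fin N) ℝ) i⟫_ℝ ^ 2 :=
      fun i => by
      rw [Finset.sum_add_distrib, Finset.sum_const, Finset.card_univ, Fintype.card_fin, nsmul_eq_mul, mul_one,
        Finset.mul_sum]
    simp_rw [h1]
    rw [Finset.sum_add_distrib, Finset.sum_const, Finset.card_univ, Fintype.card_fin, nsmul_eq_mul, ← Finset.mul_sum,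
      sum_sum_inner_basis_sq]
  simp_rw [← Finset.mul_sum]
  rw [hS]
  ring

end Triangle


/-! ## §5 (1.24) AT THE INDEX `(0,3)`: the third right-derivative of `log∫dφ e^{−S^ε}` at `λ = 0⁺`, `e = 0`, with print's
series `δm² = λδm²_{(0,1)} + λ²δm²_{(0,2)}` inserted in (1.20) — general `δm²_{(0,1)}, δm²_{(0,2)}` in cumulant form, and AT
PRINT'S `δm²_{(0,1)} = −4(N+2)C^ε_0(0)` the triangle alone -/

section IndexZeroThree

/-- **(1.24), `β = 3`, `e = 0`, WITH THE COUNTERTERM SERIES OF (1.23) — CUMULANT FORM (any `δ₁ = δm²_{(0,1)}`, `δ₂ = δm²_{(0,2)}`)**: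
`(∂/∂λ)³ log∫dφ e^{−S^ε}∣_{λ=0⁺} = −κ₃(V₁) + 3δ₂·Cov(V₁,Q)` in Mathlib's `iteratedDerivWithin 3 · (Set.Ici 0) 0`, where
`V₁ = Σ_yη^d∣φ(y)∣⁴ + ½δ₁Σ_yη^d∣φ(y)∣²` is the order-`λ` part and `½δ₂Σ_yη^d∣φ(y)∣²` the order-`λ²` part of the exponent of
(1.20) (`e = 0`), and `κ₃`, `Cov` are the free-field cumulants (`E = Z⁻¹∫W·`): the third joint cumulant of the interaction and
three times the covariance of the `(0,2)` mass vertex with it.  The `e = 0` vector field integrates out of (1.24) (numerator =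
denominator factor), so the scalar integral is the whole story at `α = 0`. [cite: Balaban1983Higgs3, (1.24) p.417, (1.20) p.416,
(1.23) p.417] [cite: GlimmJaffeQP1987, §8.4–8.5] -/
theorem iteratedDerivWithin_three_logZct (hw : 0 < w) (hm : 0 < m2) (δ₁ δ₂ : ℝ) :
    iteratedDerivWithin 3 (fun lam : ℝ => Real.log (∫ φ, weight C η w c m2 (0 : VecField P j ℝ) φ *
        (Real.exp (-(lam * ((∑ y : Site P j, w * ‖φ y‖ ^ 4) + 1 / 2 * δ₁ * massForm w φ)
          + lam ^ 2 * (1 / 2 * δ₂ * massForm w φ))) * 1))) (Set.Ici 0) 0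
      = -((∫ φ, weight C η w c m2 (0 : VecField P j ℝ) φ * ((∑ y : Site P j, w * ‖φ y‖ ^ 4) + 1 / 2 * δ₁ * massForm w φ) ^ 3) / (∫ φ, weight C η w c m2 (0 : VecField P j ℝ) φ)
            - 3 * (∫ φ, weight C η w c m2 (0 : VecField P j ℝ) φ * ((∑ y : Site P j, w * ‖φ y‖ ^ 4) + 1 / 2 * δ₁ * massForm w φ) ^ 2)
              * (∫ φ, weight C η w c m2 (0 : VecField P j ℝ) φ * ((∑ y : Site P j, w * ‖φ y‖ ^ 4) + 1 / 2 * δ₁ * massForm w φ)) / (∫ φ, weight C η w c m2 (0 : VecField P j ℝ) φ) ^ 2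
            + 2 * (∫ φ, weight C η w c m2 (0 : VecField P j ℝ) φ * ((∑ y : Site P j, w * ‖φ y‖ ^ 4) + 1 / 2 * δ₁ * massForm w φ)) ^ 3 / (∫ φ, weight C η w c m2 (0 : VecField P j ℝ) φ) ^ 3)
        + 3 * δ₂ * ((∫ φ, weight C η w c m2 (0 : VecField P j ℝ) φ * (((∑ y : Site P j, w * ‖φ y‖ ^ 4) + 1 / 2 * δ₁ * massForm w φ) * massForm w φ))
              / (∫ φ, weight C η w c m2 (0 : VecField P j ℝ) φ)
            - (∫ φ, weight C η w c m2 (0 : VecField P j ℝ) φ * ((∑ y : Site P j, w * ‖φ y‖ ^ 4) + 1 / 2 * δ₁ * massForm w φ))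
              * (∫ φ, weight C η w c m2 (0 : VecField P j ℝ) φ * massForm w φ) / (∫ φ, weight C η w c m2 (0 : VecField P j ℝ) φ) ^ 2) := by
  have hK : (0 : ℝ) ≤ Fintype.card (Site P j) * w * (δ₁ ^ 2 / 16) := by positivity
  have h := iteratedDerivWithin_three_logMoment C η w c m2 hw hm (expGrowth_V1 w δ₁) hK
    (fun φ => neg_le_V1 w hw.le δ₁ φ) (1 / 2 * δ₂)
  rw [h]
  ring

/-- **(1.20)'S OWN SPELLING**: with `δm² = λδ₁ + λ²δ₂` inserted in the mass term of (1.20) (`e = 0`), `log∫dφ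
e^{−½⟨φ,(−Δ^η+m²+δm²)φ⟩−λΣ_yη^d∣φ(y)∣⁴}` IS the function differentiated above (the counterterm is a mass shift,
`weight_counterterm_eq`). [cite: Balaban1983Higgs3, (1.20) p.416, (1.23)–(1.24) p.417] -/
theorem logZct_eq (δ₁ δ₂ : ℝ) :
    (fun lam : ℝ => Real.log (∫ φ, weight C η w c (m2 + (lam * δ₁ + lam ^ 2 * δ₂)) (0 : VecField P j ℝ) φ *
        Real.exp (-(lam * ∑ y : Site P j, w * ‖φ y‖ ^ 4))))
      = fun lam : ℝ => Real.log (∫ φ, weight C η w c m2 (0 : VecField P j ℝ) φ *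
        (Real.exp (-(lam * ((∑ y : Site P j, w * ‖φ y‖ ^ 4) + 1 / 2 * δ₁ * massForm w φ)
          + lam ^ 2 * (1 / 2 * δ₂ * massForm w φ))) * 1)) := by
  funext lam
  congr 1
  exact integral_congr_ae (Filter.Eventually.of_forall fun φ => by
    show weight C η w c (m2 + (lam * δ₁ + lam ^ 2 * δ₂)) (0 : VecField P j ℝ) φ *
        Real.exp (-(lam * ∑ y : Site P j, w * ‖φ y‖ ^ 4)) = weight C η w c m2 (0 : VecField P j ℝ) φ * (Real.exp (-(lam * ((∑ y : Site P j, w * ‖φ y‖ ^ 4)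
          + 1 / 2 * δ₁ * massForm w φ) + lam ^ 2 * (1 / 2 * δ₂ * massForm w φ))) * 1)
    rw [mul_one, weight_counterterm_eq C η w c m2 lam δ₁ δ₂ φ])

/-- **AT PRINT'S `δm²_{(0,1)} = −4(N+2)C^ε_0(0)` THE INTERACTION IS WICK-ORDERED UP TO A CONSTANT**:
`Σ_yη^d∣φ(y)∣⁴ + ½δm²_{(0,1)}Σ_yη^d∣φ(y)∣² = Σ_yη^d:∣φ(y)∣⁴: − ∣T∣η^dN(N+2)C^ε_0(0)²` (the `:∣φ∣²:`-admixture of the plain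
vertex, coefficient `2(N+2)C^ε_0(0) + ½δm²_{(0,1)}`, vanishes exactly at print's value — the solution of the `(0,1)` condition,
BRICK 10 `condition_01_iff`). [cite: Balaban1983Higgs3, (1.22) p.416, (1.23) p.417] [cite: GlimmJaffeQP1987, (9.1.5)] -/
theorem V1_eq_sumWick4_sub_const (δ₁ : ℝ) (hδ₁ : δ₁ = -(4 * (N + 2) * C0 (P := P) (j := j) w c m2)) (φ : Cfg P j N) :
    (∑ y : Site P j, w * ‖φ y‖ ^ 4) + 1 / 2 * δ₁ * massForm w φ
      = (∑ y : Site P j, w * wick4 w c m2 y φ) - Fintype.card (Site P j) * w * (N * (N + 2) * C0 (P := P) (j := j) w c m2 ^ 2) := by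
  unfold massForm
  rw [Finset.mul_sum, ← Finset.sum_add_distrib]
  have hy : ∀ y : Site P j, w * ‖φ y‖ ^ 4 + 1 / 2 * δ₁ * (w * ‖φ y‖ ^ 2)
      = w * wick4 w c m2 y φ - w * (N * (N + 2) * C0 (P := P) (j := j) w c m2 ^ 2) := fun y => by
    rw [norm_four_eq_wick w c m2 y φ, wick2_def, G_diag w c m2 y, hδ₁]
    ring
  rw [Finset.sum_congr rfl fun y _ => hy y, Finset.sum_sub_distrib, Finset.sum_const, Finset.card_univ, nsmul_eq_mul]
  ring

/-- `∫W(Σ_yη^d:∣φ(y)∣⁴:)·Σ_zη^d∣φ(z)∣² = 0` — the mass vertex (1.7) cannot close a vacuum graph with ONE Wick-ordered quartic vertex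
(`:∣φ∣⁴:` against `:∣φ∣²: + N·C(z,z)`: BRICK 1 `integral_wick4_wick2`, `integral_wick4`). [cite: GlimmJaffeQP1987, Cor. 8.3.2] -/
theorem integral_sumWick4_massForm (hw : 0 < w) (hm : 0 < m2) :
    ∫ φ, weight C η w c m2 (0 : VecField P j ℝ) φ * ((∑ y : Site P j, w * wick4 w c m2 y φ) * massForm w φ) = 0 := by
  have hyz : ∀ y z : Site P j, ∫ φ, weight C η w c m2 (0 : VecField P j ℝ) φ * (wick4 w c m2 y φ * ‖φ z‖ ^ 2) = 0 := fun y z => by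
    have e : (fun φ : Cfg P j N => weight C η w c m2 (0 : VecField P j ℝ) φ * (wick4 w c m2 y φ * ‖φ z‖ ^ 2)) = fun φ =>
        weight C η w c m2 (0 : VecField P j ℝ) φ * (wick4 w c m2 y φ * wick2 w c m2 z φ + (N * G w c m2 z z) * wick4 w c m2 y φ) := by
      funext φ; rw [wick2_def]; ring
    rw [e, integral_W_add C η w c m2 hw hm ((expGrowth_wick4 w c m2 y).mul (expGrowth_wick2 w c m2 z))
      ((expGrowth_wick4 w c m2 y).const_mul _), integral_W_const_mul, integral_wick4_wick2 C η w c m2 hw hm y z,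
      integral_wick4 C η w c m2 hw hm y]
    ring
  have e1 : (fun φ : Cfg P j N => weight C η w c m2 (0 : VecField P j ℝ) φ * ((∑ y : Site P j, w * wick4 w c m2 y φ) * massForm w φ))
      = fun φ => ∑ y : Site P j, ∑ z : Site P j, weight C η w c m2 (0 : VecField P j ℝ) φ * ((w * w) * (wick4 w c m2 y φ * ‖φ z‖ ^ 2)) := by
    funext φ
    unfold massForm
    rw [Finset.sum_mul_sum, Finset.mul_sum]
    refine Finset.sum_congr rfl fun y _ => ?_
    rw [Finset.mul_sum]
    exact Finset.sum_congr rfl fun z _ => by ring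
  have hi : ∀ y z : Site P j, Integrable (fun φ : Cfg P j N => weight C η w c m2 (0 : VecField P j ℝ) φ * ((w * w) * (wick4 w c m2 y φ * ‖φ z‖ ^ 2))) :=
    fun y z => (((expGrowth_wick4 w c m2 y).mul (ExpGrowth.norm_sq_apply z)).const_mul _).integrable C η w c m2 hw hm
  rw [e1, integral_finsetSum _ (fun y _ => integrable_finsetSum _ fun z _ => hi y z)]
  refine Finset.sum_eq_zero fun y _ => ?_
  rw [integral_finsetSum _ (fun z _ => hi y z)]
  refine Finset.sum_eq_zero fun z _ => ?_
  rw [integral_W_const_mul, hyz y z, mul_zero]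

/-- `∫W(Σ_yη^d:∣φ(y)∣⁴:)³ = 64N(N+2)(N+8)·Z·Σ_{y₁,y₂,y₃}η^{3d}C(y₂,y₁)²C(y₃,y₁)²C(y₃,y₂)²` — the third moment of the Wick-ordered
interaction is the sum of the triangles (§4). [cite: Balaban1983Higgs3, (1.24) p.417] [cite: GlimmJaffeQP1987, §8.3] -/
theorem integral_sumWick4_cube (hw : 0 < w) (hm : 0 < m2) :
    ∫ φ, weight C η w c m2 (0 : VecField P j ℝ) φ * (∑ y : Site P j, w * wick4 w c m2 y φ) ^ 3
      = 64 * (N * (N + 2) * (N + 8)) * (∫ φ, weight C η w c m2 (0 : VecField P j ℝ) φ) *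
        ∑ y₁ : Site P j, ∑ y₂ : Site P j, ∑ y₃ : Site P j, w ^ 3 *
          (G w c m2 y₂ y₁ ^ 2 * G w c m2 y₃ y₁ ^ 2 * G w c m2 y₃ y₂ ^ 2) := by
  have e1 : (fun φ : Cfg P j N => weight C η w c m2 (0 : VecField P j ℝ) φ * (∑ y : Site P j, w * wick4 w c m2 y φ) ^ 3)
      = fun φ => ∑ y₁ : Site P j, ∑ y₂ : Site P j, ∑ y₃ : Site P j,
          weight C η w c m2 (0 : VecField P j ℝ) φ * (w ^ 3 * (wick4 w c m2 y₁ φ * (wick4 w c m2 y₂ φ * wick4 w c m2 y₃ φ))) := by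
    funext φ
    simp_rw [pow_three, Finset.sum_mul, Finset.mul_sum]
    exact Finset.sum_congr rfl fun y₁ _ => Finset.sum_congr rfl fun y₂ _ => Finset.sum_congr rfl fun y₃ _ => by ring
  have hi : ∀ y₁ y₂ y₃ : Site P j, Integrable (fun φ : Cfg P j N =>
      weight C η w c m2 (0 : VecField P j ℝ) φ * (w ^ 3 * (wick4 w c m2 y₁ φ * (wick4 w c m2 y₂ φ * wick4 w c m2 y₃ φ)))) := fun y₁ y₂ y₃ =>
    (((expGrowth_wick4 w c m2 y₁).mul ((expGrowth_wick4 w c m2 y₂).mul (expGrowth_wick4 w c m2 y₃))).const_mul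
      _).integrable C η w c m2 hw hm
  rw [e1, integral_finsetSum _ (fun y₁ _ => integrable_finsetSum _ fun y₂ _ =>
    integrable_finsetSum _ fun y₃ _ => hi y₁ y₂ y₃)]
  rw [Finset.mul_sum]
  refine Finset.sum_congr rfl fun y₁ _ => ?_
  rw [integral_finsetSum _ (fun y₂ _ => integrable_finsetSum _ fun y₃ _ => hi y₁ y₂ y₃), Finset.mul_sum]
  refine Finset.sum_congr rfl fun y₂ _ => ?_
  rw [integral_finsetSum _ (fun y₃ _ => hi y₁ y₂ y₃), Finset.mul_sum]
  refine Finset.sum_congr rfl fun y₃ _ => ?_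
  rw [integral_W_const_mul, integral_wick4_wick4_wick4 C η w c m2 hw hm y₁ y₂ y₃]
  ring

/-- **(1.24) AT THE INDEX `(0,3)`, AT PRINT'S `δm²_{(0,1)}` — THE TRIANGLE WITH DOUBLED LINES, AND `δm²_{(0,2)}` DROPS OUT**:
with `δ₁ = −4(N+2)C^ε_0(0)` (the solution of print's `(0,1)` equation, (1.23)'s first displayed counterterm) and ANY `δ₂`,
`(∂/∂λ)³ log∫dφ e^{−S^ε}∣_{λ=0⁺} = −64N(N+2)(N+8)·Σ_{y₁,y₂,y₃}η^{3d}C^ε_0(y₂,y₁)²C^ε_0(y₃,y₁)²C^ε_0(y₃,y₂)²` (`e = 0`): the third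
cumulant of the Wick-ordered interaction is its third moment — the single connected vacuum graph with three Wick-ordered quartic
vertices, every pair joined by two lines — and the covariance of the `(0,2)` mass vertex with the Wick-ordered interaction
vanishes (`integral_sumWick4_massForm`), so the inserted `λ²δm²_{(0,2)}` does not enter this index.  Print: *"Terms of this
expansion are described by connected graphs without external legs (vacuum graphs)"* (p. 418; v1.1: referee-1 N-ref1-g114-1 —
v1.0 wrote «p. 417» here). [cite: Balaban1983Higgs3, (1.24) p.417, p.418, (1.22)–(1.23) pp.416–417] [cite: GlimmJaffeQP1987, §8.4–8.5] -/
theorem iteratedDerivWithin_three_logZct_at_dm2One (hw : 0 < w) (hm : 0 < m2) (δ₁ δ₂ : ℝ)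
    (hδ₁ : δ₁ = -(4 * (N + 2) * C0 (P := P) (j := j) w c m2)) :
    iteratedDerivWithin 3 (fun lam : ℝ => Real.log (∫ φ, weight C η w c m2 (0 : VecField P j ℝ) φ *
        (Real.exp (-(lam * ((∑ y : Site P j, w * ‖φ y‖ ^ 4) + 1 / 2 * δ₁ * massForm w φ)
          + lam ^ 2 * (1 / 2 * δ₂ * massForm w φ))) * 1))) (Set.Ici 0) 0
      = -(64 * (N * (N + 2) * (N + 8)) *
          ∑ y₁ : Site P j, ∑ y₂ : Site P j, ∑ y₃ : Site P j, w ^ 3 *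
            (G w c m2 y₂ y₁ ^ 2 * G w c m2 y₃ y₁ ^ 2 * G w c m2 y₃ y₂ ^ 2)) := by
  rw [iteratedDerivWithin_three_logZct C η w c m2 hw hm δ₁ δ₂]
  -- the interaction at print's `δ₁`: `V₁ = U − K₀`, `U = Σ_yη^d:∣φ(y)∣⁴:`
  set K₀ : ℝ := Fintype.card (Site P j) * w * (N * (N + 2) * C0 (P := P) (j := j) w c m2 ^ 2) with hK₀
  have hV : ∀ φ : Cfg P j N, (∑ y : Site P j, w * ‖φ y‖ ^ 4) + 1 / 2 * δ₁ * massForm w φ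
      = (∑ y : Site P j, w * wick4 w c m2 y φ) - K₀ := fun φ => V1_eq_sumWick4_sub_const w c m2 δ₁ hδ₁ φ
  have hU := expGrowth_sum_wick4 (P := P) (j := j) (N := N) w c m2
  have hQ := expGrowth_massForm' (P := P) (j := j) (N := N) w
  have h1g := ExpGrowth.const (P := P) (j := j) (N := N) (1 : ℝ)
  have hU0 := integral_sumWick4 (P := P) (j := j) C η w c m2 hw hm
  have hUQ := integral_sumWick4_massForm (P := P) (j := j) C η w c m2 hw hm
  have hU3 := integral_sumWick4_cube (P := P) (j := j) C η w c m2 hw hm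
  -- the moments of `V₁` through those of `U`
  have hI1 : ∫ φ, weight C η w c m2 (0 : VecField P j ℝ) φ * ((∑ y : Site P j, w * ‖φ y‖ ^ 4) + 1 / 2 * δ₁ * massForm w φ)
      = -K₀ * ∫ φ, weight C η w c m2 (0 : VecField P j ℝ) φ := by
    have e : (fun φ : Cfg P j N => weight C η w c m2 (0 : VecField P j ℝ) φ * ((∑ y : Site P j, w * ‖φ y‖ ^ 4) + 1 / 2 * δ₁ * massForm w φ))
        = fun φ => weight C η w c m2 (0 : VecField P j ℝ) φ * ((∑ y : Site P j, w * wick4 w c m2 y φ) + (-K₀) * 1) := by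
      funext φ; rw [hV φ]; ring
    rw [e, integral_W_add C η w c m2 hw hm hU (h1g.const_mul _), integral_W_const_mul, hU0]
    simp only [mul_one]
    ring
  have hI2 : ∫ φ, weight C η w c m2 (0 : VecField P j ℝ) φ * ((∑ y : Site P j, w * ‖φ y‖ ^ 4) + 1 / 2 * δ₁ * massForm w φ) ^ 2
      = (∫ φ, weight C η w c m2 (0 : VecField P j ℝ) φ * (∑ y : Site P j, w * wick4 w c m2 y φ) ^ 2) + K₀ ^ 2 * ∫ φ, weight C η w c m2 (0 : VecField P j ℝ) φ := by
    have e : (fun φ : Cfg P j N => weight C η w c m2 (0 : VecField P j ℝ) φ * ((∑ y : Site P j, w * ‖φ y‖ ^ 4) + 1 / 2 * δ₁ * massForm w φ) ^ 2)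
        = fun φ => weight C η w c m2 (0 : VecField P j ℝ) φ * ((∑ y : Site P j, w * wick4 w c m2 y φ) ^ 2
          + ((-(2 * K₀)) * (∑ y : Site P j, w * wick4 w c m2 y φ) + K₀ ^ 2 * 1)) := by
      funext φ; rw [hV φ]; ring
    rw [e, integral_W_add C η w c m2 hw hm (expGrowth_pow hU 2) ((hU.const_mul _).add (h1g.const_mul _)),
      integral_W_add C η w c m2 hw hm (hU.const_mul _) (h1g.const_mul _), integral_W_const_mul, integral_W_const_mul,
      hU0]
    simp only [mul_one]
    ring
  have hI3 : ∫ φ, weight C η w c m2 (0 : VecField P j ℝ) φ * ((∑ y : Site P j, w * ‖φ y‖ ^ 4) + 1 / 2 * δ₁ * massForm w φ) ^ 3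
      = (∫ φ, weight C η w c m2 (0 : VecField P j ℝ) φ * (∑ y : Site P j, w * wick4 w c m2 y φ) ^ 3)
        + (-(3 * K₀)) * (∫ φ, weight C η w c m2 (0 : VecField P j ℝ) φ * (∑ y : Site P j, w * wick4 w c m2 y φ) ^ 2) + (-(K₀ ^ 3)) * ∫ φ, weight C η w c m2 (0 : VecField P j ℝ) φ := by
    have e : (fun φ : Cfg P j N => weight C η w c m2 (0 : VecField P j ℝ) φ * ((∑ y : Site P j, w * ‖φ y‖ ^ 4) + 1 / 2 * δ₁ * massForm w φ) ^ 3)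
        = fun φ => weight C η w c m2 (0 : VecField P j ℝ) φ * ((∑ y : Site P j, w * wick4 w c m2 y φ) ^ 3
          + ((-(3 * K₀)) * (∑ y : Site P j, w * wick4 w c m2 y φ) ^ 2
            + ((3 * K₀ ^ 2) * (∑ y : Site P j, w * wick4 w c m2 y φ) + (-(K₀ ^ 3)) * 1))) := by
      funext φ; rw [hV φ]; ring
    rw [e, integral_W_add C η w c m2 hw hm (expGrowth_pow hU 3)
      (((expGrowth_pow hU 2).const_mul _).add ((hU.const_mul _).add (h1g.const_mul _))),
      integral_W_add C η w c m2 hw hm ((expGrowth_pow hU 2).const_mul _) ((hU.const_mul _).add (h1g.const_mul _)),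
      integral_W_add C η w c m2 hw hm (hU.const_mul _) (h1g.const_mul _),
      integral_W_const_mul, integral_W_const_mul, integral_W_const_mul, hU0]
    simp only [mul_one]
    ring
  have hIQ : ∫ φ, weight C η w c m2 (0 : VecField P j ℝ) φ * (((∑ y : Site P j, w * ‖φ y‖ ^ 4) + 1 / 2 * δ₁ * massForm w φ) * massForm w φ)
      = -K₀ * ∫ φ, weight C η w c m2 (0 : VecField P j ℝ) φ * massForm w φ := by
    have e : (fun φ : Cfg P j N => weight C η w c m2 (0 : VecField P j ℝ) φ * (((∑ y : Site P j, w * ‖φ y‖ ^ 4) + 1 / 2 * δ₁ * massForm w φ) * massForm w φ))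
        = fun φ => weight C η w c m2 (0 : VecField P j ℝ) φ * ((∑ y : Site P j, w * wick4 w c m2 y φ) * massForm w φ + (-K₀) * massForm w φ) := by
      funext φ; rw [hV φ]; ring
    rw [e, integral_W_add C η w c m2 hw hm (hU.mul hQ) (hQ.const_mul _), integral_W_const_mul, hUQ]
    ring
  rw [hI1, hI2, hI3, hIQ, hU3]
  have hZ : (∫ φ, weight C η w c m2 (0 : VecField P j ℝ) φ) ≠ 0 := (B3WT226Traces.Z_pos C η w c m2 hw hm).ne'
  field_simp
  ring

/-- **THE HEADLINE IN (1.20)'S OWN SPELLING**: with print's series `δm² = λδm²_{(0,1)} + λ²δm²_{(0,2)}` inserted in the mass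
term of (1.20) (`e = 0`), `δm²_{(0,1)} = −4(N+2)C^ε_0(0)` and ANY `δm²_{(0,2)}`:
`(∂/∂λ)³∣_{λ=0⁺} log∫dφ e^{−½⟨φ,(−Δ^ε+m²+δm²)φ⟩ − λΣ_xε^d∣φ(x)∣⁴} = −64N(N+2)(N+8)Σ_{y₁,y₂,y₃}ε^{3d}C^ε_0(y₂,y₁)²C^ε_0(y₃,y₁)²C^ε_0(y₃,y₂)²`.
[cite: Balaban1983Higgs3, (1.20) p.416, (1.23)–(1.24) p.417] -/
theorem iteratedDerivWithin_three_logZ_counterterm_at_dm2One (hw : 0 < w) (hm : 0 < m2) (δ₁ δ₂ : ℝ)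
    (hδ₁ : δ₁ = -(4 * (N + 2) * C0 (P := P) (j := j) w c m2)) :
    iteratedDerivWithin 3 (fun lam : ℝ => Real.log (∫ φ, weight C η w c (m2 + (lam * δ₁ + lam ^ 2 * δ₂)) (0 : VecField P j ℝ) φ *
        Real.exp (-(lam * ∑ y : Site P j, w * ‖φ y‖ ^ 4)))) (Set.Ici 0) 0
      = -(64 * (N * (N + 2) * (N + 8)) *
          ∑ y₁ : Site P j, ∑ y₂ : Site P j, ∑ y₃ : Site P j, w ^ 3 *
            (G w c m2 y₂ y₁ ^ 2 * G w c m2 y₃ y₁ ^ 2 * G w c m2 y₃ y₂ ^ 2)) := by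
  rw [logZct_eq C η w c m2 δ₁ δ₂]
  exact iteratedDerivWithin_three_logZct_at_dm2One C η w c m2 hw hm δ₁ δ₂ hδ₁

/-- **THE `(α,β) = (0,3)` TERM OF `E₁` IN (1.24)** — `(1/(0!3!))e⁰λ³(∂³/∂λ³) log∫dA∫dφ e^{−S^ε}∣_{e=λ=0}` with print's counterterms
inserted (`e = 0`: the vector field integrates out), the `λ`-derivative read one-sidedly at `0⁺` (`iteratedDerivWithin … (Set.Ici 0)
0`, as r01's `B1Sect1Statements.ModelData.e1R` reads (1.24)): **`= −(32/3)N(N+2)(N+8)·λ³·Σ_{y₁,y₂,y₃}ε^{3d}C^ε_0(y₂,y₁)²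
C^ε_0(y₃,y₁)²C^ε_0(y₃,y₂)²`** — print's picture: the vacuum triangle of three (1.6)-vertices with doubled lines (combinatoric factor
DERIVED, *"we did not write … combinatoric factors before the graphs"* p. 416); the last PURE-`λ` index of p. 418's
`2 ≤ α+2β ≤ 6`. [cite: Balaban1983Higgs3, (1.24) p.417, p.418] -/
theorem E1_term_03_at_dm2One (hw : 0 < w) (hm : 0 < m2) (δ₁ δ₂ lam : ℝ)
    (hδ₁ : δ₁ = -(4 * (N + 2) * C0 (P := P) (j := j) w c m2)) :
    1 / ((Nat.factorial 0 : ℝ) * Nat.factorial 3) * lam ^ 3 *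
        iteratedDerivWithin 3 (fun lam : ℝ => Real.log (∫ φ, weight C η w c (m2 + (lam * δ₁ + lam ^ 2 * δ₂)) (0 : VecField P j ℝ) φ *
          Real.exp (-(lam * ∑ y : Site P j, w * ‖φ y‖ ^ 4)))) (Set.Ici 0) 0
      = -(32 / 3 * (N * (N + 2) * (N + 8))) * lam ^ 3 *
          ∑ y₁ : Site P j, ∑ y₂ : Site P j, ∑ y₃ : Site P j, w ^ 3 *
            (G w c m2 y₂ y₁ ^ 2 * G w c m2 y₃ y₁ ^ 2 * G w c m2 y₃ y₂ ^ 2) := by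
  rw [iteratedDerivWithin_three_logZ_counterterm_at_dm2One C η w c m2 hw hm δ₁ δ₂ hδ₁]
  simp only [Nat.factorial, Nat.succ_eq_add_one, Nat.cast_one, Nat.cast_mul]
  ring

end IndexZeroThree


/-! ## §6 EXTENSIVITY: the (0,3) vacuum term is `∣T_ε∣` times a density — translation invariance of `C^ε_0` on the torus (the
per-volume normalization of the vacuum energy, B1's (1.14)) -/

section Extensive

omit C η w c m2 in
/-- a translation-invariant function on the torus sums to `∣T∣` times its value at any base point. [folklore] -/
private theorem sum_eq_card_mul_of_transl {f : Site P j → ℝ} (hf : ∀ t y, f (transl t y) = f y) (y₀ : Site P j) :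
    ∑ y : Site P j, f y = (Fintype.card (Site P j) : ℝ) * f y₀ := by
  have h : ∀ y : Site P j, f y = f y₀ := fun y => by
    have := hf (fun μ => y μ - y₀ μ) y₀
    have hx : transl (fun μ => y μ - y₀ μ) y₀ = y := by funext μ; simp [transl]
    rw [hx] at this
    exact this
  rw [Finset.sum_congr rfl fun y _ => h y, Finset.sum_const, Finset.card_univ, nsmul_eq_mul]

omit C η w c m2 in
/-- a sum over the torus is invariant under translating the summation variable. [folklore] -/
private theorem sum_transl (t : Site P j) (g : Site P j → ℝ) : ∑ y : Site P j, g (transl t y) = ∑ y : Site P j, g y :=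
  Fintype.sum_equiv (translEquiv t) _ _ fun _ => rfl

omit C η in
/-- **THE TRIANGLE SUM IS EXTENSIVE**: `Σ_{y₁,y₂,y₃}ε^{3d}C(y₂,y₁)²C(y₃,y₁)²C(y₃,y₂)² = ∣T_ε∣·Σ_{y₂,y₃}ε^{3d}C(y₂,y₀)²C(y₃,y₀)²C(y₃,y₂)²`
for every base point `y₀` (translation invariance of `C^ε_0`, `B3WTCovariance.G_transl`): the `(0,3)` term of `E₁` is the volume
times a density, as the per-volume bound (1.14) of part I requires. [cite: Balaban1983Higgs3, (1.24) p.417]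
[cite: Balaban1982Higgs1, (1.14) p.606] -/
theorem triangle_sum_eq_card_mul (y₀ : Site P j) :
    ∑ y₁ : Site P j, ∑ y₂ : Site P j, ∑ y₃ : Site P j, w ^ 3 *
        (G w c m2 y₂ y₁ ^ 2 * G w c m2 y₃ y₁ ^ 2 * G w c m2 y₃ y₂ ^ 2)
      = (Fintype.card (Site P j) : ℝ) * ∑ y₂ : Site P j, ∑ y₃ : Site P j, w ^ 3 *
        (G w c m2 y₂ y₀ ^ 2 * G w c m2 y₃ y₀ ^ 2 * G w c m2 y₃ y₂ ^ 2) := by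
  refine sum_eq_card_mul_of_transl (fun t y => ?_) y₀
  rw [← sum_transl t (fun y₂ => ∑ y₃ : Site P j, w ^ 3 *
    (G w c m2 y₂ (transl t y) ^ 2 * G w c m2 y₃ (transl t y) ^ 2 * G w c m2 y₃ y₂ ^ 2))]
  refine Finset.sum_congr rfl fun y₂ _ => ?_
  rw [← sum_transl t (fun y₃ => w ^ 3 *
    (G w c m2 (transl t y₂) (transl t y) ^ 2 * G w c m2 y₃ (transl t y) ^ 2 * G w c m2 y₃ (transl t y₂) ^ 2))]
  refine Finset.sum_congr rfl fun y₃ _ => ?_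
  rw [G_transl, G_transl, G_transl]

/-- **(1.24) AT `(0,3)`, AT PRINT'S `δm²_{(0,1)}`, AS VOLUME × DENSITY**:
`(∂/∂λ)³ log∫dφ e^{−S^ε}∣_{λ=0⁺} = −∣T_ε∣·64N(N+2)(N+8)Σ_{y₂,y₃}ε^{3d}C^ε_0(y₂−y₀)²C^ε_0(y₃−y₀)²C^ε_0(y₃−y₂)²`.
[cite: Balaban1983Higgs3, (1.24) p.417] [cite: Balaban1982Higgs1, (1.14) p.606] -/
theorem iteratedDerivWithin_three_logZct_at_dm2One_eq_card_mul (hw : 0 < w) (hm : 0 < m2) (δ₁ δ₂ : ℝ)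
    (hδ₁ : δ₁ = -(4 * (N + 2) * C0 (P := P) (j := j) w c m2)) (y₀ : Site P j) :
    iteratedDerivWithin 3 (fun lam : ℝ => Real.log (∫ φ, weight C η w c m2 (0 : VecField P j ℝ) φ *
        (Real.exp (-(lam * ((∑ y : Site P j, w * ‖φ y‖ ^ 4) + 1 / 2 * δ₁ * massForm w φ)
          + lam ^ 2 * (1 / 2 * δ₂ * massForm w φ))) * 1))) (Set.Ici 0) 0
      = -((Fintype.card (Site P j) : ℝ) * (64 * (N * (N + 2) * (N + 8)) *
          ∑ y₂ : Site P j, ∑ y₃ : Site P j, w ^ 3 *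
            (G w c m2 y₂ y₀ ^ 2 * G w c m2 y₃ y₀ ^ 2 * G w c m2 y₃ y₂ ^ 2))) := by
  rw [iteratedDerivWithin_three_logZct_at_dm2One C η w c m2 hw hm δ₁ δ₂ hδ₁, triangle_sum_eq_card_mul w c m2 y₀]
  ring

end Extensive

end Literature.MathematicalPhysics.QuantumFieldTheory.Balaban1983to89.B3Eq124IndexZeroThree

end
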